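import Literature.Topology.FourManifolds.GenusOneSblfOnSphereFour
import Literature.Topology.FourManifolds.SimplifiedBrokenLefschetzFibrationProofs
import Literature.Topology.FourManifolds.SmoothOrientationSphereProofs
import Literature.Geometry.Manifold.InverseFunctionTheorem
import Literature.AlgebraicTopology.SingularHomology.CircleProductHomology
import Literature.Topology.FourManifolds.BraidFramingEstimates
import Mathlib.Analysis.SpecialFunctions.Trigonometric.Deriv
import Mathlib.Analysis.SpecialFunctions.Complex.Circle
import HarnessLib

/-!
# An explicit genus-one simplified broken Lefschetz fibration `S⁴ → S²` (proof of the named fact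
# `exists_sblf_genus_one_noLefschetz_sphere_four`)

Topic `Literature/Topology/FourManifolds`, the `…Proofs` sibling of
`GenusOneSblfOnSphereFour.lean`, which carries ONE named fact: Auroux–Donaldson–Katzarkov 2005,
§8.2, Example 1 — the unit sphere `S⁴` carries a smooth orientation `o` and a map `f : S⁴ → S²`
with `IsSimplifiedBrokenLefschetzFibration o f ∅ 0` (genus one, lower genus zero, non-empty
connected round locus, NO Lefschetz point).  This file PROVES it
(`exists_sblf_genus_one_noLefschetz_sphere_four_holds`); nothing is asserted, no definition of the
tree is restated.

## The proof

The printed argument (*"`X_- ∪ W ≃ S¹ × B³`, and by gluing `X_+ = D² × S²` along the boundary we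
obtain `X' ≃ S⁴`"*) is a handle/gluing construction, for which Mathlib has no vocabulary.  We
replace it by an EXPLICIT real-algebraic model of the same fibration on the round sphere and check
every clause of `IsSimplifiedBrokenLefschetzFibration` by direct computation.  Write
`ℝ⁵ = ℝ × ℂ × ℂ ∋ (x₀, z, w)`, fix `0 < ρ < 1` (we take `ρ = 1/2`) and put
`u := (|w|² - ρ) + i x₀`.  On `S⁴` the pair `(z, u)` never vanishes, and

  `f := [z : u] ∈ CP¹ = S²`, concretely `f = V/N`, `V = (2 z ū, |z|² - |u|²)`, `N = |z|² + |u|²`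

(the Hopf quotient of `(z, u)`; `AdkSphereFour.adkMap`).  Then:

* `f` is smooth and onto (`contMDiff_adkMap`, `surjective_adkMap`);
* the critical set is EXACTLY the circle `Z = {x₀ = 0, w = 0}` (`|z| = 1`)
  (`not_surjective_mfderiv_iff`): off `Z` two explicit tangent vectors have independent images
  (the infinitesimal `z`-rotation, which `f` intertwines with the rotation of `S²` about its axis,
  and a radial-exchange vector moving the height; `surjective_mfderiv_adkMap`), and at the points
  of `Z` the map has the indefinite fold normal form `(t, x₁² + x₂² - x₃²)` of Hayano 2011,
  Def. 2.1 (4) in the explicit coordinates `Ψ = (y₁c₁ - y₀c₂, ρ² - (1 - y₂)/(1 + y₂))` of `S²` and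
  `Φ = (Ψ₀ ∘ f, x₃ S, x₄ S, x₀ S')`, `S = √((2ρ - ρ² - |w|²)/|z|²)`, `S' = √((1 + ρ²)/|z|²)` of
  `S⁴` — an exact algebraic identity (`psiE_mapE_one_eq`); both are charts by the tree's manifold
  inverse function theorem (`exists_foldChart`), so `Z` is the round locus, a connected circle on
  which `f(0, z, 0) = (-2ρ z, 1 - ρ²)/(1 + ρ²)` is injective;
* the critical values form the latitude circle `y₂ = h_c = (1 - ρ²)/(1 + ρ²)`; the fibre over
  the north pole is the torus `{x₀ = 0, |w|² = ρ}` (`≃ₜ S¹ × S¹`, `H₁ ≅ ℤ²` by the tree's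
  `nonempty_singularHomology_torus_equiv`), the fibre over the south pole is the 2-sphere `{z = 0}`
  (`H₁ = 0`, `isZero_singularHomology_unitSphere`), and by the tree's PROVED Ehresmann theorem
  (`isFibreBundleWith_restrictPreimage`) every fibre over the open connected caps `y₂ > h_c`,
  resp. `y₂ < h_c`, is homeomorphic to the polar one.

All differentials are computed in the ambient spaces: `dι ∘ df = Df̃ ∘ dι` for the inclusions
`ι` of the spheres (Mathlib's `range_mfderiv_coe_sphere`, `mfderiv_coe_sphere_injective`), see
`surjective_mfderiv_of_pair` and `injective_mfderiv_comp_coe_sphere`; directional derivatives of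
`V/N` are read off the expansions of `V` and `N` along lines as quartics in the parameter
(`hasDerivAt_mapE_line`).

## Main results

* `AdkSphereFour.adkMap` — the map `f : S⁴ → S²`; `AdkSphereFour.not_surjective_mfderiv_iff` —
  its critical set; `AdkSphereFour.exists_foldChart` — the fold charts;
  `AdkSphereFour.isSimplifiedBrokenLefschetzFibration_adkMap` — all clauses, for every `0 < ρ < 1`
  and every smooth orientation of `S⁴`.
* `exists_sblf_genus_one_noLefschetz_sphere_four_holds` — the discharge.
* `AdkSphereFour.isPreconnected_sphere_inner_lt` — open caps `{⟪y, v⟫ < c}` of a round sphere are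
  preconnected (inverse stereographic image of a ball), a lemma of independent use.

Deliberately NOT here: the identification of this fibration with the "twisted" gluing of the
source (only the properties recorded by `IsSimplifiedBrokenLefschetzFibration` are proved; the
total space is `S⁴` by construction), monodromy, and any statement for other total spaces.

## References

* D. Auroux, S. K. Donaldson, L. Katzarkov, *Singular Lefschetz pencils*, Geom. Topol. 9 (2005)
  1043–1114, §8.2 Example 1. [AurouxDonaldsonKatzarkov2005]
* K. Hayano, *On genus-1 simplified broken Lefschetz fibrations*, Algebr. Geom. Topol. 11 (2011),
  Def. 2.1 (4) (the indefinite fold model). [Hayano2011]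
* A. Hatcher, *Algebraic Topology* (2002), Cor. 2.14 (`H₁(S²) = 0`), §3.3 p. 231 (`H₁(T²)`).
  [HatcherAT2002]
* T. Bröcker, K. Jänich, *Introduction to Differential Topology* (1982), (8.12) (Ehresmann).
  [BrockerJanichIDT1982]
* J. M. Lee, *Introduction to Smooth Manifolds*, 2nd ed. (2013), Thm. 4.5 (inverse function
  theorem). [LeeSmoothManifolds2013]
-/

noncomputable section

open scoped Manifold ContDiff Topology
open Set Function Metric

namespace Literature.Topology.FourManifolds

/-! The grouping namespace `AdkSphereFour` names the object constructed here: the explicit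
Auroux–Donaldson–Katzarkov fibration of the round `S⁴`. -/
namespace AdkSphereFour

local notation "E5" => EuclideanSpace ℝ (Fin 5)
local notation "E3" => EuclideanSpace ℝ (Fin 3)
local notation "E2" => EuclideanSpace ℝ (Fin 2)
local notation "E4" => EuclideanSpace ℝ (Fin 4)
local notation "𝕊⁴" => Metric.sphere (0 : EuclideanSpace ℝ (Fin 5)) (1 : ℝ)
local notation "𝕊²" => Metric.sphere (0 : EuclideanSpace ℝ (Fin 3)) (1 : ℝ)

variable {ρ : ℝ}

/-- `dim ℝ⁵ = 4 + 1`, the (local) instance under which Mathlib's sphere lemmas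
(`contMDiff_coe_sphere`, `range_mfderiv_coe_sphere`, …) see `S⁴ ⊆ ℝ⁵`. [folklore] -/
theorem factFinrankFive : Fact (Module.finrank ℝ (EuclideanSpace ℝ (Fin 5)) = 4 + 1) :=
  ⟨finrank_euclideanSpace_fin⟩

/-- `dim ℝ³ = 2 + 1`, the (local) instance under which Mathlib's sphere lemmas see `S² ⊆ ℝ³`.
[folklore] -/
theorem factFinrankThree : Fact (Module.finrank ℝ (EuclideanSpace ℝ (Fin 3)) = 2 + 1) :=
  ⟨finrank_euclideanSpace_fin⟩

attribute [local instance] factFinrankFive factFinrankThree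

/-- Real part of the second homogeneous coordinate `u = (|w|² - ρ) + i x₀`. [folklore] -/
def reU (ρ : ℝ) (x : E5) : ℝ := x 3 ^ 2 + x 4 ^ 2 - ρ

/-- `N = |z|² + |u|²`. [folklore] -/
def nrm (ρ : ℝ) (x : E5) : ℝ := x 1 ^ 2 + x 2 ^ 2 + reU ρ x ^ 2 + x 0 ^ 2

/-- `V = (2 Re(z ū), 2 Im(z ū), |z|² - |u|²)`. [folklore] -/
def hopfV (ρ : ℝ) (x : E5) : E3 :=
  WithLp.toLp 2 ![2 * (x 1 * reU ρ x + x 2 * x 0), 2 * (x 2 * reU ρ x - x 1 * x 0),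
    x 1 ^ 2 + x 2 ^ 2 - reU ρ x ^ 2 - x 0 ^ 2]

/-- The ambient map `ℝ⁵ → ℝ³`, `x ↦ V(x) / N(x)`. [folklore] -/
def mapE (ρ : ℝ) (x : E5) : E3 := (nrm ρ x)⁻¹ • hopfV ρ x

/-- First coordinate of `V`: `2 Re(z ū)`. [folklore] -/
@[simp] theorem hopfV_apply_zero (x : E5) : hopfV ρ x 0 = 2 * (x 1 * reU ρ x + x 2 * x 0) := by
  simp [hopfV]

/-- Second coordinate of `V`: `2 Im(z ū)`. [folklore] -/
@[simp] theorem hopfV_apply_one (x : E5) : hopfV ρ x 1 = 2 * (x 2 * reU ρ x - x 1 * x 0) := by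
  simp [hopfV]

/-- Third coordinate of `V`: `|z|² - |u|²`. [folklore] -/
@[simp] theorem hopfV_apply_two (x : E5) :
    hopfV ρ x 2 = x 1 ^ 2 + x 2 ^ 2 - reU ρ x ^ 2 - x 0 ^ 2 := by
  simp [hopfV]

/-- Coordinates of `V/N`. [folklore] -/
theorem mapE_apply (x : E5) (i : Fin 3) : mapE ρ x i = (nrm ρ x)⁻¹ * hopfV ρ x i := by
  simp [mapE]

/-- `N ≥ 0`. [folklore] -/
theorem nrm_nonneg (x : E5) : 0 ≤ nrm ρ x := by
  unfold nrm; positivity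

/-- `‖V‖² = N²`. [folklore] -/
theorem norm_hopfV_sq (x : E5) : ‖hopfV ρ x‖ ^ 2 = nrm ρ x ^ 2 := by
  rw [EuclideanSpace.real_norm_sq_eq, Fin.sum_univ_three, hopfV_apply_zero, hopfV_apply_one,
    hopfV_apply_two]
  unfold nrm
  ring

/-- `‖V‖ = N`. [folklore] -/
theorem norm_hopfV (x : E5) : ‖hopfV ρ x‖ = nrm ρ x := by
  have h := norm_hopfV_sq (ρ := ρ) x
  nlinarith [norm_nonneg (hopfV ρ x), nrm_nonneg (ρ := ρ) x, sq_nonneg (‖hopfV ρ x‖ - nrm ρ x),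
    sq_nonneg (‖hopfV ρ x‖ + nrm ρ x)]

/-- `V/N` is a unit vector wherever `N ≠ 0`. [folklore] -/
theorem norm_mapE {x : E5} (hx : nrm ρ x ≠ 0) : ‖mapE ρ x‖ = 1 := by
  rw [mapE, norm_smul, norm_inv, Real.norm_eq_abs, abs_of_nonneg (nrm_nonneg x), norm_hopfV,
    inv_mul_cancel₀ hx]

/-- Coordinates of a point of the unit sphere `S⁴ ⊆ ℝ⁵` have squares summing to `1`. [folklore] -/
theorem sum_sq_eq_one (p : 𝕊⁴) :
    (p : E5) 0 ^ 2 + (p : E5) 1 ^ 2 + (p : E5) 2 ^ 2 + (p : E5) 3 ^ 2 + (p : E5) 4 ^ 2 = 1 := by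
  have h : ‖(p : E5)‖ = 1 := by simp
  have h2 := EuclideanSpace.real_norm_sq_eq (p : E5)
  rw [h, Fin.sum_univ_five] at h2
  linarith

/-- Coordinates of a point of the unit sphere `S² ⊆ ℝ³` have squares summing to `1`. [folklore] -/
theorem sum_sq_eq_one₂ (y : 𝕊²) :
    (y : E3) 0 ^ 2 + (y : E3) 1 ^ 2 + (y : E3) 2 ^ 2 = 1 := by
  have h : ‖(y : E3)‖ = 1 := by simp
  have h2 := EuclideanSpace.real_norm_sq_eq (y : E3)
  rw [h, Fin.sum_univ_three] at h2
  linarith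

/-- On the sphere, `|z|² = 1 - x₀² - |w|²`. [folklore] -/
theorem zsq_eq (p : 𝕊⁴) :
    (p : E5) 1 ^ 2 + (p : E5) 2 ^ 2 = 1 - (p : E5) 0 ^ 2 - ((p : E5) 3 ^ 2 + (p : E5) 4 ^ 2) := by
  have := sum_sq_eq_one p; linarith

/-- `N > 0` on the sphere as soon as `ρ ≠ 1`. [folklore] -/
theorem nrm_pos (hρ : ρ ≠ 1) (p : 𝕊⁴) : 0 < nrm ρ p := by
  have hs := sum_sq_eq_one p
  unfold nrm reU
  by_contra h
  push Not at h
  set a := (p : E5) 0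
  set b := (p : E5) 1
  set c := (p : E5) 2
  set d := (p : E5) 3
  set e := (p : E5) 4
  have h1 : b = 0 := by
    nlinarith [sq_nonneg b, sq_nonneg c, sq_nonneg a, sq_nonneg (d ^ 2 + e ^ 2 - ρ)]
  have h2 : c = 0 := by
    nlinarith [sq_nonneg b, sq_nonneg c, sq_nonneg a, sq_nonneg (d ^ 2 + e ^ 2 - ρ)]
  have h3 : a = 0 := by
    nlinarith [sq_nonneg b, sq_nonneg c, sq_nonneg a, sq_nonneg (d ^ 2 + e ^ 2 - ρ)]
  have h4 : d ^ 2 + e ^ 2 - ρ = 0 := by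
    nlinarith [sq_nonneg b, sq_nonneg c, sq_nonneg a, sq_nonneg (d ^ 2 + e ^ 2 - ρ)]
  apply hρ
  nlinarith

/-- `V/N` maps `S⁴` into `S²` as soon as `ρ ≠ 1`. [folklore] -/
theorem mapE_mem_sphere (hρ : ρ ≠ 1) (p : 𝕊⁴) : mapE ρ (p : E5) ∈ 𝕊² := by
  rw [mem_sphere_zero_iff_norm]
  exact norm_mapE (nrm_pos hρ p).ne'

/-- **The map `f : S⁴ → S²`.** [cite: AurouxDonaldsonKatzarkov2005, §8.2 Example 1] -/
def adkMap (hρ : ρ ≠ 1) : 𝕊⁴ → 𝕊² :=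
  Set.codRestrict (fun p : 𝕊⁴ => mapE ρ (p : E5)) _ (mapE_mem_sphere hρ)

/-- The underlying vector of `f p` is `(V/N)(p)`. [folklore] -/
@[simp] theorem coe_adkMap (hρ : ρ ≠ 1) (p : 𝕊⁴) : (adkMap hρ p : E3) = mapE ρ (p : E5) := rfl

/-! ### Smoothness -/

/-- `Re u` is smooth. [folklore] -/
theorem contDiff_reU : ContDiff ℝ ∞ (reU ρ) := by
  unfold reU; fun_prop

/-- `N` is smooth. [folklore] -/
theorem contDiff_nrm : ContDiff ℝ ∞ (nrm ρ) := by
  unfold nrm reU; fun_prop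

/-- `V` is smooth. [folklore] -/
theorem contDiff_hopfV : ContDiff ℝ ∞ (hopfV ρ) := by
  rw [contDiff_euclidean]
  intro i
  fin_cases i
  · simp only [hopfV_apply_zero, Fin.zero_eta]; unfold reU; fun_prop
  · simp only [hopfV_apply_one, Fin.mk_one]; unfold reU; fun_prop
  · simp only [Fin.reduceFinMk, hopfV_apply_two]; unfold reU; fun_prop

/-- `V/N` is smooth wherever `N ≠ 0`. [folklore] -/
theorem contDiffAt_mapE {x : E5} (hx : nrm ρ x ≠ 0) : ContDiffAt ℝ ∞ (mapE ρ) x := by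
  unfold mapE
  exact (contDiff_nrm.contDiffAt.inv hx).smul contDiff_hopfV.contDiffAt

/-- **`f` is smooth** (a smooth ambient map restricted and corestricted to spheres, Mathlib's `contMDiff_coe_sphere` and `ContMDiff.codRestrict_sphere`). [folklore] -/
theorem contMDiff_adkMap (hρ : ρ ≠ 1) : ContMDiff (𝓡 4) (𝓡 2) ∞ (adkMap hρ) := by
  have h1 : ContMDiff (𝓡 4) 𝓘(ℝ, E3) ∞ (fun p : 𝕊⁴ => mapE ρ (p : E5)) := fun p =>
    (contDiffAt_mapE (nrm_pos hρ p).ne').contMDiffAt.comp p (contMDiff_coe_sphere p)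
  exact h1.codRestrict_sphere (mapE_mem_sphere hρ)

/-- `f` is continuous. [folklore] -/
theorem continuous_adkMap (hρ : ρ ≠ 1) : Continuous (adkMap hρ) :=
  (contMDiff_adkMap hρ).continuous


/-! ### Differentials on spheres, read in the ambient spaces -/

/-- **Injectivity of the differential of `Φ̃ ∘ ι` from the ambient Jacobian**: if the ambient
derivative `B` of `Φ̃` at `p` kills no non-zero vector orthogonal to `p`, then the differential of
the restriction of `Φ̃` to the sphere is injective. [folklore] -/
theorem injective_mfderiv_comp_coe_sphere {n : ℕ} {E : Type*} [NormedAddCommGroup E]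
    [InnerProductSpace ℝ E] [Fact (Module.finrank ℝ E = n + 1)] {F : Type*}
    [NormedAddCommGroup F] [NormedSpace ℝ F] {Φt : E → F} {p : sphere (0 : E) 1}
    {B : E →L[ℝ] F} (hB : HasFDerivAt Φt B p)
    (hker : ∀ v : E, inner ℝ (p : E) v = 0 → B v = 0 → v = 0) :
    Injective (mfderiv (𝓡 n) 𝓘(ℝ, F) (Φt ∘ Subtype.val) p) := by
  have hval : HasMFDerivAt (𝓡 n) 𝓘(ℝ, E) (Subtype.val : sphere (0 : E) 1 → E) p
      (mfderiv (𝓡 n) 𝓘(ℝ, E) (Subtype.val : sphere (0 : E) 1 → E) p) :=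
    ((contMDiff_coe_sphere (n := n) p).mdifferentiableAt one_ne_zero).hasMFDerivAt
  rw [(hB.hasMFDerivAt.comp p hval).mfderiv]
  refine (injective_iff_map_eq_zero _).2 fun u hu => ?_
  apply (injective_iff_map_eq_zero _).1 (mfderiv_coe_sphere_injective (n := n) p) u
  set w : E := mfderiv (𝓡 n) 𝓘(ℝ, E) (Subtype.val : sphere (0 : E) 1 → E) p u with hw
  have hmem : w ∈ (ℝ ∙ (p : E))ᗮ := by
    rw [← range_mfderiv_coe_sphere (n := n) p]
    exact ⟨u, rfl⟩
  exact hker w ((Submodule.mem_orthogonal_singleton_iff_inner_right (𝕜 := ℝ)).1 hmem) hu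

/-- **Surjectivity of the differential of a map between spheres from the ambient Jacobian**: if
`g : S⁴ → S²` is the restriction of an ambient map `G` with derivative `A` at `p`, and two vectors
orthogonal to `p` have linearly independent images under `A`, then `dg_p` is onto (the images lie
in the `2`-plane `T_{g p} S²`). [folklore] -/
theorem surjective_mfderiv_of_pair {G : E5 → E3} {g : 𝕊⁴ → 𝕊²}
    (hg : ∀ q, (g q : E3) = G q) {p : 𝕊⁴} (hgp : MDifferentiableAt (𝓡 4) (𝓡 2) g p)
    {A : E5 →L[ℝ] E3} (hA : HasFDerivAt G A p) {v₁ v₂ : E5}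
    (hv₁ : inner ℝ (p : E5) v₁ = 0) (hv₂ : inner ℝ (p : E5) v₂ = 0)
    (hind : LinearIndependent ℝ ![A v₁, A v₂]) :
    Surjective (mfderiv (𝓡 4) (𝓡 2) g p) := by
  have hval4 : HasMFDerivAt (𝓡 4) 𝓘(ℝ, E5) (Subtype.val : 𝕊⁴ → E5) p
      (mfderiv (𝓡 4) 𝓘(ℝ, E5) (Subtype.val : 𝕊⁴ → E5) p) :=
    ((contMDiff_coe_sphere (n := 4) p).mdifferentiableAt one_ne_zero).hasMFDerivAt
  have hval2 : HasMFDerivAt (𝓡 2) 𝓘(ℝ, E3) (Subtype.val : 𝕊² → E3) (g p)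
      (mfderiv (𝓡 2) 𝓘(ℝ, E3) (Subtype.val : 𝕊² → E3) (g p)) :=
    ((contMDiff_coe_sphere (n := 2) (g p)).mdifferentiableAt one_ne_zero).hasMFDerivAt
  set T := mfderiv (𝓡 4) (𝓡 2) g p with hT
  set ι₄ := mfderiv (𝓡 4) 𝓘(ℝ, E5) (Subtype.val : 𝕊⁴ → E5) p
  set ι₂ := mfderiv (𝓡 2) 𝓘(ℝ, E3) (Subtype.val : 𝕊² → E3) (g p)
  have h1 : HasMFDerivAt (𝓡 4) 𝓘(ℝ, E3) (Subtype.val ∘ g) p (ι₂.comp T) :=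
    hval2.comp p hgp.hasMFDerivAt
  have h2 : HasMFDerivAt (𝓡 4) 𝓘(ℝ, E3) (G ∘ Subtype.val) p (A.comp ι₄) :=
    hA.hasMFDerivAt.comp p hval4
  have hfun : (Subtype.val ∘ g : 𝕊⁴ → E3) = G ∘ Subtype.val := funext fun q => hg q
  rw [hfun] at h1
  have key : ι₂.comp T = A.comp ι₄ := h1.mfderiv.symm.trans h2.mfderiv
  -- the two tangent vectors
  have hr : ∀ v : E5, inner ℝ (p : E5) v = 0 → ∃ u, ι₄ u = v := fun v hv => by
    have : v ∈ (ℝ ∙ ((p : 𝕊⁴) : E5))ᗮ :=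
      (Submodule.mem_orthogonal_singleton_iff_inner_right).2 hv
    rw [← range_mfderiv_coe_sphere (n := 4) p] at this
    exact this
  obtain ⟨u₁, hu₁⟩ := hr v₁ hv₁
  obtain ⟨u₂, hu₂⟩ := hr v₂ hv₂
  have hι : ∀ u, ι₂ (T u) = A (ι₄ u) := fun u => DFunLike.congr_fun key u
  have hind' : LinearIndependent ℝ ![T u₁, T u₂] := by
    refine LinearIndependent.pair_iff.2 fun s t hst => ?_
    have h0 : s • A v₁ + t • A v₂ = 0 := by
      have := congrArg ι₂ hst
      rw [map_add, map_smul, map_smul, map_zero, hι, hι, hu₁, hu₂] at this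
      exact this
    exact LinearIndependent.pair_iff.1 hind s t h0
  have hcard : Fintype.card (Fin 2) = Module.finrank ℝ (TangentSpace (𝓡 2) (g p)) := by
    change Fintype.card (Fin 2) = Module.finrank ℝ (EuclideanSpace ℝ (Fin 2))
    simp
  set b := basisOfLinearIndependentOfCardEqFinrank hind' hcard with hb
  intro w
  refine ⟨∑ i, b.repr w i • ![u₁, u₂] i, ?_⟩
  rw [map_sum]
  conv_rhs => rw [← b.sum_repr w]
  refine Finset.sum_congr rfl fun i _ => ?_
  rw [map_smul, hb, coe_basisOfLinearIndependentOfCardEqFinrank]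
  fin_cases i <;> simp

/-! ### Directional derivatives of the ambient map along lines -/

/-- Derivative at `0` of a quartic written out in coefficients. [folklore] -/
theorem hasDerivAt_quartic (c₀ c₁ c₂ c₃ c₄ : ℝ) :
    HasDerivAt (fun t : ℝ => c₀ + c₁ * t + c₂ * t ^ 2 + c₃ * t ^ 3 + c₄ * t ^ 4) c₁ 0 := by
  have h : HasDerivAt (fun t : ℝ => c₀ + c₁ * t + c₂ * t ^ 2 + c₃ * t ^ 3 + c₄ * t ^ 4) _ 0 :=
    HasDerivAt.fun_add (HasDerivAt.fun_add (HasDerivAt.fun_add (HasDerivAt.fun_add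
      (hasDerivAt_const (0 : ℝ) c₀) ((hasDerivAt_id' (0 : ℝ)).const_mul c₁))
      ((hasDerivAt_pow 2 (0 : ℝ)).const_mul c₂))
      ((hasDerivAt_pow 3 (0 : ℝ)).const_mul c₃))
      ((hasDerivAt_pow 4 (0 : ℝ)).const_mul c₄)
  refine h.congr_deriv ?_
  norm_num

/-- Directional derivative of a component of `V / N` along the line `p + t v`, from the
expansions of the numerator and of `N` as quartics in `t`. [folklore] -/
theorem hasDerivAt_mapE_line {p v : E5} {i : Fin 3} (q₀ q₁ q₂ q₃ q₄ d₀ d₁ d₂ d₃ d₄ : ℝ)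
    (hq : ∀ t : ℝ, hopfV ρ (p + t • v) i = q₀ + q₁ * t + q₂ * t ^ 2 + q₃ * t ^ 3 + q₄ * t ^ 4)
    (hd : ∀ t : ℝ, nrm ρ (p + t • v) = d₀ + d₁ * t + d₂ * t ^ 2 + d₃ * t ^ 3 + d₄ * t ^ 4)
    (hd₀ : d₀ ≠ 0) :
    HasDerivAt (fun t : ℝ => mapE ρ (p + t • v) i) ((q₁ * d₀ - q₀ * d₁) / d₀ ^ 2) 0 := by
  have hfun : (fun t : ℝ => mapE ρ (p + t • v) i) = fun t =>
      (q₀ + q₁ * t + q₂ * t ^ 2 + q₃ * t ^ 3 + q₄ * t ^ 4) /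
        (d₀ + d₁ * t + d₂ * t ^ 2 + d₃ * t ^ 3 + d₄ * t ^ 4) := by
    funext t
    rw [mapE_apply, hq, hd, inv_mul_eq_div]
  rw [hfun]
  have h := (hasDerivAt_quartic q₀ q₁ q₂ q₃ q₄).div (hasDerivAt_quartic d₀ d₁ d₂ d₃ d₄)
    (by simpa using hd₀)
  refine h.congr_deriv ?_
  simp

/-- A directional derivative computed along a line is the corresponding entry of the ambient
Jacobian: `(D(V/N)_p v)_i`. [folklore] -/
theorem fderiv_mapE_apply_eq {p v : E5} (hp : nrm ρ p ≠ 0) {i : Fin 3} {c : ℝ}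
    (h : HasDerivAt (fun t : ℝ => mapE ρ (p + t • v) i) c 0) :
    fderiv ℝ (mapE ρ) p v i = c := by
  have hA : HasFDerivAt (mapE ρ) (fderiv ℝ (mapE ρ) p) (p + (0 : ℝ) • v) := by
    rw [zero_smul, add_zero]
    exact ((contDiffAt_mapE hp).differentiableAt (by simp)).hasFDerivAt
  have hl : HasDerivAt (fun t : ℝ => p + t • v) v 0 := by
    simpa using ((hasDerivAt_id (0 : ℝ)).smul_const v).const_add p
  have hc := hA.comp_hasDerivAt (0 : ℝ) hl
  have hi : HasDerivAt ((EuclideanSpace.proj i) ∘ (mapE ρ ∘ fun t : ℝ => p + t • v))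
      ((EuclideanSpace.proj i) (fderiv ℝ (mapE ρ) p v)) 0 :=
    ((EuclideanSpace.proj i).hasFDerivAt).comp_hasDerivAt (0 : ℝ) hc
  exact hi.unique h

/-- The full directional derivative `D(V/N)_p v` as the velocity of `t ↦ (V/N)(γ t)` for any curve
`γ` through `p` with velocity `v`. [folklore] -/
theorem hasDerivAt_mapE_comp {p v : E5} (hp : nrm ρ p ≠ 0) {γ : ℝ → E5} (hγ0 : γ 0 = p)
    (hγ : HasDerivAt γ v 0) :
    HasDerivAt (fun t : ℝ => mapE ρ (γ t)) (fderiv ℝ (mapE ρ) p v) 0 := by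
  have hA : HasFDerivAt (mapE ρ) (fderiv ℝ (mapE ρ) p) (γ 0) := by
    rw [hγ0]
    exact ((contDiffAt_mapE hp).differentiableAt (by simp)).hasFDerivAt
  exact hA.comp_hasDerivAt (0 : ℝ) hγ


/-! ### Coordinates, auxiliary vectors and inner products -/

/-- `|z|² = x₁² + x₂²`. [folklore] -/
def zsq (p : E5) : ℝ := p 1 ^ 2 + p 2 ^ 2

/-- `|w|² = x₃² + x₄²`. [folklore] -/
def wsq (p : E5) : ℝ := p 3 ^ 2 + p 4 ^ 2

/-- `Re u = |w|² - ρ`. [folklore] -/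
theorem reU_eq (p : E5) : reU ρ p = wsq p - ρ := rfl

/-- `N = |z|² + (Re u)² + x₀²`. [folklore] -/
theorem nrm_eq (p : E5) : nrm ρ p = zsq p + reU ρ p ^ 2 + p 0 ^ 2 := by
  unfold nrm zsq; ring

/-- `|z|² ≥ 0`. [folklore] -/
theorem zsq_nonneg (p : E5) : 0 ≤ zsq p := by unfold zsq; positivity

/-- `|w|² ≥ 0`. [folklore] -/
theorem wsq_nonneg (p : E5) : 0 ≤ wsq p := by unfold wsq; positivity

/-- The inner product of `ℝ⁵` in coordinates. [folklore] -/
theorem inner_five (x y : E5) :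
    inner ℝ x y = x 0 * y 0 + x 1 * y 1 + x 2 * y 2 + x 3 * y 3 + x 4 * y 4 := by
  simp [PiLp.inner_apply, Fin.sum_univ_five, mul_comm]

/-- The inner product of `ℝ³` in coordinates. [folklore] -/
theorem inner_three (x y : E3) : inner ℝ x y = x 0 * y 0 + x 1 * y 1 + x 2 * y 2 := by
  simp [PiLp.inner_apply, Fin.sum_univ_three, mul_comm]

/-- Extensionality in `ℝ³`, coordinatewise. [folklore] -/
theorem ext_three {a b : E3} (h0 : a 0 = b 0) (h1 : a 1 = b 1) (h2 : a 2 = b 2) : a = b := by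
  ext i
  fin_cases i
  · exact h0
  · exact h1
  · exact h2

/-- Extensionality in `ℝ⁵`, coordinatewise. [folklore] -/
theorem ext_five {a b : E5} (h0 : a 0 = b 0) (h1 : a 1 = b 1) (h2 : a 2 = b 2) (h3 : a 3 = b 3)
    (h4 : a 4 = b 4) : a = b := by
  ext i
  fin_cases i
  · exact h0
  · exact h1
  · exact h2
  · exact h3
  · exact h4

/-- The infinitesimal rotation of the `z`-plane at `p`: `(0, -x₂, x₁, 0, 0)`. [folklore] -/
def rotVec (p : E5) : E5 := WithLp.toLp 2 ![0, -p 2, p 1, 0, 0]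

/-- `(0, x₁, x₂, 0, 0)`. [folklore] -/
def zVec (p : E5) : E5 := WithLp.toLp 2 ![0, p 1, p 2, 0, 0]

/-- The rotation of the `z`-plane by the angle `t`, as a curve through `p`. [folklore] -/
def rotCurve (p : E5) (t : ℝ) : E5 := p + (Real.cos t - 1) • zVec p + Real.sin t • rotVec p

/-- The infinitesimal rotation about the vertical axis at `y ∈ ℝ³`: `(-y₁, y₀, 0)`. [folklore] -/
def rotVec₃ (y : E3) : E3 := WithLp.toLp 2 ![-y 1, y 0, 0]

/-- `(y₀, y₁, 0)`. [folklore] -/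
def zVec₃ (y : E3) : E3 := WithLp.toLp 2 ![y 0, y 1, 0]

/-- The radial-exchange vector `(|z|², -x₀x₁, -x₀x₂, 0, 0)`, tangent to the sphere. [folklore] -/
def vA (p : E5) : E5 := WithLp.toLp 2 ![zsq p, -(p 0 * p 1), -(p 0 * p 2), 0, 0]

/-- The radial-exchange vector `(0, |w|²x₁, |w|²x₂, -|z|²x₃, -|z|²x₄)`, tangent to the sphere.
[folklore] -/
def vB (p : E5) : E5 := WithLp.toLp 2 ![0, wsq p * p 1, wsq p * p 2, -(zsq p * p 3), -(zsq p * p 4)]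

/-- The coordinate vector `e₀`. [folklore] -/
def e0 : E5 := WithLp.toLp 2 ![1, 0, 0, 0, 0]

/-- The coordinate vector `e₁`. [folklore] -/
def e1 : E5 := WithLp.toLp 2 ![0, 1, 0, 0, 0]

/-- The coordinate vector `e₂`. [folklore] -/
def e2 : E5 := WithLp.toLp 2 ![0, 0, 1, 0, 0]

/-- The infinitesimal rotation is tangent to the sphere through `p`. [folklore] -/
theorem inner_rotVec (p : E5) : inner ℝ p (rotVec p) = 0 := by
  rw [inner_five]; simp [rotVec]; ring

/-- `vA` is tangent to the sphere through `p`. [folklore] -/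
theorem inner_vA (p : E5) : inner ℝ p (vA p) = 0 := by
  rw [inner_five]; simp [vA, zsq]; ring

/-- `vB` is tangent to the sphere through `p`. [folklore] -/
theorem inner_vB (p : E5) : inner ℝ p (vB p) = 0 := by
  rw [inner_five]; simp [vB, zsq, wsq]; ring

/-! ### Equivariance under the rotations of the `z`-plane -/

/-- `N` is invariant under the `z`-rotations. [folklore] -/
theorem nrm_rotCurve (p : E5) (t : ℝ) : nrm ρ (rotCurve p t) = nrm ρ p := by
  have h := Real.cos_sq_add_sin_sq t
  simp only [nrm, reU, rotCurve, zVec, rotVec, PiLp.add_apply, PiLp.smul_apply, smul_eq_mul]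
  simp
  linear_combination (p 1 ^ 2 + p 2 ^ 2) * h

/-- `V₀` rotates under the `z`-rotations. [folklore] -/
theorem hopfV_rotCurve_zero (p : E5) (t : ℝ) :
    hopfV ρ (rotCurve p t) 0 = Real.cos t * hopfV ρ p 0 - Real.sin t * hopfV ρ p 1 := by
  simp only [hopfV_apply_zero, hopfV_apply_one, reU, rotCurve, zVec, rotVec, PiLp.add_apply,
    PiLp.smul_apply, smul_eq_mul]
  simp
  ring

/-- `V₁` rotates under the `z`-rotations. [folklore] -/
theorem hopfV_rotCurve_one (p : E5) (t : ℝ) :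
    hopfV ρ (rotCurve p t) 1 = Real.cos t * hopfV ρ p 1 + Real.sin t * hopfV ρ p 0 := by
  simp only [hopfV_apply_zero, hopfV_apply_one, reU, rotCurve, zVec, rotVec, PiLp.add_apply,
    PiLp.smul_apply, smul_eq_mul]
  simp
  ring

/-- `V₂` is invariant under the `z`-rotations. [folklore] -/
theorem hopfV_rotCurve_two (p : E5) (t : ℝ) : hopfV ρ (rotCurve p t) 2 = hopfV ρ p 2 := by
  have h := Real.cos_sq_add_sin_sq t
  simp only [hopfV_apply_two, reU, rotCurve, zVec, rotVec, PiLp.add_apply, PiLp.smul_apply,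
    smul_eq_mul]
  simp
  linear_combination (p 1 ^ 2 + p 2 ^ 2) * h

/-- **`z`-rotations of the source are rotations of the target**: `(V/N)(R_t p) = Rot_t (V/N)(p)`.
[folklore] -/
theorem mapE_rotCurve (p : E5) (t : ℝ) :
    mapE ρ (rotCurve p t) =
      mapE ρ p + (Real.cos t - 1) • zVec₃ (mapE ρ p) + Real.sin t • rotVec₃ (mapE ρ p) := by
  ext i
  fin_cases i
  · simp only [Fin.zero_eta, PiLp.add_apply, PiLp.smul_apply, smul_eq_mul]
    rw [mapE_apply, mapE_apply, nrm_rotCurve, hopfV_rotCurve_zero]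
    simp [zVec₃, rotVec₃, mapE_apply]
    ring
  · simp only [Fin.mk_one, PiLp.add_apply, PiLp.smul_apply, smul_eq_mul]
    rw [mapE_apply, mapE_apply, nrm_rotCurve, hopfV_rotCurve_one]
    simp [zVec₃, rotVec₃, mapE_apply]
    ring
  · simp only [Fin.reduceFinMk, PiLp.add_apply, PiLp.smul_apply, smul_eq_mul]
    rw [mapE_apply, mapE_apply, nrm_rotCurve, hopfV_rotCurve_two]
    simp [zVec₃, rotVec₃, mapE_apply]

/-- The velocity of the rotation curve at `t = 0` is the infinitesimal rotation. [folklore] -/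
theorem hasDerivAt_rotCurve (p : E5) : HasDerivAt (rotCurve p) (rotVec p) 0 := by
  have h : HasDerivAt (rotCurve p) _ 0 :=
    (((Real.hasDerivAt_cos 0).sub_const 1).smul_const (zVec p)).const_add p |>.add
      ((Real.hasDerivAt_sin 0).smul_const (rotVec p))
  refine h.congr_deriv ?_
  simp

/-- The velocity of the target rotation at `t = 0` is the infinitesimal rotation of the target. [folklore] -/
theorem hasDerivAt_rot₃ (y : E3) :
    HasDerivAt (fun t : ℝ => y + (Real.cos t - 1) • zVec₃ y + Real.sin t • rotVec₃ y)
      (rotVec₃ y) 0 := by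
  have h : HasDerivAt (fun t : ℝ => y + (Real.cos t - 1) • zVec₃ y + Real.sin t • rotVec₃ y)
      _ 0 :=
    (((Real.hasDerivAt_cos 0).sub_const 1).smul_const (zVec₃ y)).const_add y |>.add
      ((Real.hasDerivAt_sin 0).smul_const (rotVec₃ y))
  refine h.congr_deriv ?_
  simp

/-- **The Jacobian on the infinitesimal rotation**: `D(V/N)_p (0,-x₂,x₁,0,0) = (-y₁, y₀, 0)` where
`y = (V/N)(p)`. [folklore] -/
theorem fderiv_mapE_rotVec {p : E5} (hp : nrm ρ p ≠ 0) :
    fderiv ℝ (mapE ρ) p (rotVec p) = rotVec₃ (mapE ρ p) := by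
  have h1 := hasDerivAt_mapE_comp hp (by simp [rotCurve]) (hasDerivAt_rotCurve p)
  have h2 : HasDerivAt (fun t : ℝ => mapE ρ (rotCurve p t)) (rotVec₃ (mapE ρ p)) 0 := by
    have := hasDerivAt_rot₃ (mapE ρ p)
    simp_rw [← mapE_rotCurve] at this
    exact this
  exact h1.unique h2

/-! ### Directional derivatives along the auxiliary vectors -/

/-- `(D(V/N)_p vA)_2 = -4 |z|² x₀ / N`. [folklore] -/
theorem fderiv_mapE_vA_two {p : E5} (hp : nrm ρ p ≠ 0) :
    fderiv ℝ (mapE ρ) p (vA p) 2 = -(4 * zsq p * p 0) / nrm ρ p := by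
  rw [fderiv_mapE_apply_eq hp (hasDerivAt_mapE_line (hopfV ρ p 2) (-(4 * zsq p * p 0))
    (zsq p * p 0 ^ 2 - zsq p ^ 2) 0 0 (nrm ρ p) 0 (zsq p * p 0 ^ 2 + zsq p ^ 2) 0 0 ?_ ?_ hp)]
  · field_simp
    ring
  · intro t
    simp [hopfV_apply_two, reU, zsq, vA]
    ring
  · intro t
    simp [nrm, reU, zsq, vA]
    ring

/-- `(D(V/N)_p vB)_2 = (2|z|²|w|²(1 + 2a) N - V₂ · 2|z|²|w|²(1 - 2a)) / N²`, `a = |w|² - ρ`.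
[folklore] -/
theorem fderiv_mapE_vB_two {p : E5} (hp : nrm ρ p ≠ 0) :
    fderiv ℝ (mapE ρ) p (vB p) 2 =
      (2 * zsq p * wsq p * (1 + 2 * reU ρ p) * nrm ρ p
        - hopfV ρ p 2 * (2 * zsq p * wsq p * (1 - 2 * reU ρ p))) / nrm ρ p ^ 2 := by
  rw [fderiv_mapE_apply_eq hp (hasDerivAt_mapE_line (hopfV ρ p 2)
    (2 * zsq p * wsq p * (1 + 2 * reU ρ p))
    (zsq p * wsq p ^ 2 - 4 * wsq p ^ 2 * zsq p ^ 2 - 2 * reU ρ p * wsq p * zsq p ^ 2)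
    (4 * wsq p ^ 2 * zsq p ^ 3) (-(wsq p ^ 2 * zsq p ^ 4))
    (nrm ρ p) (2 * zsq p * wsq p * (1 - 2 * reU ρ p))
    (zsq p * wsq p ^ 2 + 4 * wsq p ^ 2 * zsq p ^ 2 + 2 * reU ρ p * wsq p * zsq p ^ 2)
    (-(4 * wsq p ^ 2 * zsq p ^ 3)) (wsq p ^ 2 * zsq p ^ 4) ?_ ?_ hp)]
  · intro t
    simp [hopfV_apply_two, reU, zsq, wsq, vB]
    ring
  · intro t
    simp [nrm, reU, zsq, wsq, vB]
    ring

/-- `(D(V/N)_p vB)_0`. [folklore] -/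
theorem fderiv_mapE_vB_zero {p : E5} (hp : nrm ρ p ≠ 0) :
    fderiv ℝ (mapE ρ) p (vB p) 0 =
      (2 * wsq p * (p 1 * (reU ρ p - 2 * zsq p) + p 0 * p 2) * nrm ρ p
        - hopfV ρ p 0 * (2 * zsq p * wsq p * (1 - 2 * reU ρ p))) / nrm ρ p ^ 2 := by
  rw [fderiv_mapE_apply_eq hp (hasDerivAt_mapE_line (hopfV ρ p 0)
    (2 * wsq p * (p 1 * (reU ρ p - 2 * zsq p) + p 0 * p 2))
    (2 * p 1 * wsq p * zsq p * (zsq p - 2 * wsq p)) (2 * p 1 * wsq p ^ 2 * zsq p ^ 2) 0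
    (nrm ρ p) (2 * zsq p * wsq p * (1 - 2 * reU ρ p))
    (zsq p * wsq p ^ 2 + 4 * wsq p ^ 2 * zsq p ^ 2 + 2 * reU ρ p * wsq p * zsq p ^ 2)
    (-(4 * wsq p ^ 2 * zsq p ^ 3)) (wsq p ^ 2 * zsq p ^ 4) ?_ ?_ hp)]
  · intro t
    simp [hopfV_apply_zero, reU, zsq, wsq, vB]
    ring
  · intro t
    simp [nrm, reU, zsq, wsq, vB]
    ring

/-- `(D(V/N)_p vB)_1`. [folklore] -/
theorem fderiv_mapE_vB_one {p : E5} (hp : nrm ρ p ≠ 0) :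
    fderiv ℝ (mapE ρ) p (vB p) 1 =
      (2 * wsq p * (p 2 * (reU ρ p - 2 * zsq p) - p 0 * p 1) * nrm ρ p
        - hopfV ρ p 1 * (2 * zsq p * wsq p * (1 - 2 * reU ρ p))) / nrm ρ p ^ 2 := by
  rw [fderiv_mapE_apply_eq hp (hasDerivAt_mapE_line (hopfV ρ p 1)
    (2 * wsq p * (p 2 * (reU ρ p - 2 * zsq p) - p 0 * p 1))
    (2 * p 2 * wsq p * zsq p * (zsq p - 2 * wsq p)) (2 * p 2 * wsq p ^ 2 * zsq p ^ 2) 0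
    (nrm ρ p) (2 * zsq p * wsq p * (1 - 2 * reU ρ p))
    (zsq p * wsq p ^ 2 + 4 * wsq p ^ 2 * zsq p ^ 2 + 2 * reU ρ p * wsq p * zsq p ^ 2)
    (-(4 * wsq p ^ 2 * zsq p ^ 3)) (wsq p ^ 2 * zsq p ^ 4) ?_ ?_ hp)]
  · intro t
    simp [hopfV_apply_one, reU, zsq, wsq, vB]
    ring
  · intro t
    simp [nrm, reU, zsq, wsq, vB]
    ring

/-- `(D(V/N)_p e₀)_0 = (2 x₂ N - V₀ · 2 x₀) / N²`. [folklore] -/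
theorem fderiv_mapE_e0_zero {p : E5} (hp : nrm ρ p ≠ 0) :
    fderiv ℝ (mapE ρ) p e0 0 = (2 * p 2 * nrm ρ p - hopfV ρ p 0 * (2 * p 0)) / nrm ρ p ^ 2 := by
  rw [fderiv_mapE_apply_eq hp (hasDerivAt_mapE_line (hopfV ρ p 0) (2 * p 2) 0 0 0
    (nrm ρ p) (2 * p 0) 1 0 0 ?_ ?_ hp)]
  · intro t
    simp [hopfV_apply_zero, reU, e0]
    ring
  · intro t
    simp [nrm, reU, e0]
    ring

/-- `(D(V/N)_p e₀)_1 = (-2 x₁ N - V₁ · 2 x₀) / N²`. [folklore] -/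
theorem fderiv_mapE_e0_one {p : E5} (hp : nrm ρ p ≠ 0) :
    fderiv ℝ (mapE ρ) p e0 1 = (-(2 * p 1) * nrm ρ p - hopfV ρ p 1 * (2 * p 0)) / nrm ρ p ^ 2 := by
  rw [fderiv_mapE_apply_eq hp (hasDerivAt_mapE_line (hopfV ρ p 1) (-(2 * p 1)) 0 0 0
    (nrm ρ p) (2 * p 0) 1 0 0 ?_ ?_ hp)]
  · intro t
    simp [hopfV_apply_one, reU, e0]
    ring
  · intro t
    simp [nrm, reU, e0]
    ring

/-- `(D(V/N)_p e₁)_0 = (2a N - V₀ · 2x₁) / N²`. [folklore] -/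
theorem fderiv_mapE_e1_zero {p : E5} (hp : nrm ρ p ≠ 0) :
    fderiv ℝ (mapE ρ) p e1 0 =
      (2 * reU ρ p * nrm ρ p - hopfV ρ p 0 * (2 * p 1)) / nrm ρ p ^ 2 := by
  rw [fderiv_mapE_apply_eq hp (hasDerivAt_mapE_line (hopfV ρ p 0) (2 * reU ρ p) 0 0 0
    (nrm ρ p) (2 * p 1) 1 0 0 ?_ ?_ hp)]
  · intro t
    simp [hopfV_apply_zero, reU, e1]
    ring
  · intro t
    simp [nrm, reU, e1]
    ring

/-- `(D(V/N)_p e₁)_1 = (-2x₀ N - V₁ · 2x₁) / N²`. [folklore] -/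
theorem fderiv_mapE_e1_one {p : E5} (hp : nrm ρ p ≠ 0) :
    fderiv ℝ (mapE ρ) p e1 1 =
      (-(2 * p 0) * nrm ρ p - hopfV ρ p 1 * (2 * p 1)) / nrm ρ p ^ 2 := by
  rw [fderiv_mapE_apply_eq hp (hasDerivAt_mapE_line (hopfV ρ p 1) (-(2 * p 0)) 0 0 0
    (nrm ρ p) (2 * p 1) 1 0 0 ?_ ?_ hp)]
  · intro t
    simp [hopfV_apply_one, reU, e1]
    ring
  · intro t
    simp [nrm, reU, e1]
    ring

/-- `(D(V/N)_p e₂)_0 = (2x₀ N - V₀ · 2x₂) / N²`. [folklore] -/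
theorem fderiv_mapE_e2_zero {p : E5} (hp : nrm ρ p ≠ 0) :
    fderiv ℝ (mapE ρ) p e2 0 =
      (2 * p 0 * nrm ρ p - hopfV ρ p 0 * (2 * p 2)) / nrm ρ p ^ 2 := by
  rw [fderiv_mapE_apply_eq hp (hasDerivAt_mapE_line (hopfV ρ p 0) (2 * p 0) 0 0 0
    (nrm ρ p) (2 * p 2) 1 0 0 ?_ ?_ hp)]
  · intro t
    simp [hopfV_apply_zero, reU, e2]
    ring
  · intro t
    simp [nrm, reU, e2]
    ring

/-- `(D(V/N)_p e₂)_1 = (2a N - V₁ · 2x₂) / N²`. [folklore] -/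
theorem fderiv_mapE_e2_one {p : E5} (hp : nrm ρ p ≠ 0) :
    fderiv ℝ (mapE ρ) p e2 1 =
      (2 * reU ρ p * nrm ρ p - hopfV ρ p 1 * (2 * p 2)) / nrm ρ p ^ 2 := by
  rw [fderiv_mapE_apply_eq hp (hasDerivAt_mapE_line (hopfV ρ p 1) (2 * reU ρ p) 0 0 0
    (nrm ρ p) (2 * p 2) 1 0 0 ?_ ?_ hp)]
  · intro t
    simp [hopfV_apply_one, reU, e2]
    ring
  · intro t
    simp [nrm, reU, e2]
    ring


/-! ### Linear independence tests in `ℝ³` -/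

/-- Two vectors of `ℝ³` with a non-zero `2 × 2` minor in the first two coordinates are linearly
independent. [folklore] -/
theorem linearIndependent_of_minor {u w : E3} (h : u 0 * w 1 - u 1 * w 0 ≠ 0) :
    LinearIndependent ℝ ![u, w] := by
  refine LinearIndependent.pair_iff.2 fun s t hst => ?_
  have h0 : s * u 0 + t * w 0 = 0 := by simpa using congrArg (fun v : E3 => v 0) hst
  have h1 : s * u 1 + t * w 1 = 0 := by simpa using congrArg (fun v : E3 => v 1) hst
  have hs : s * (u 0 * w 1 - u 1 * w 0) = 0 := by linear_combination w 1 * h0 - w 0 * h1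
  have ht : t * (u 0 * w 1 - u 1 * w 0) = 0 := by linear_combination u 0 * h1 - u 1 * h0
  exact ⟨(mul_eq_zero.1 hs).resolve_right h, (mul_eq_zero.1 ht).resolve_right h⟩

/-- The infinitesimal rotation at a point off the vertical axis and a vector with non-zero
vertical component are linearly independent. [folklore] -/
theorem linearIndependent_rotVec₃ {y w : E3} (hy : y 0 ^ 2 + y 1 ^ 2 ≠ 0) (hw : w 2 ≠ 0) :
    LinearIndependent ℝ ![rotVec₃ y, w] := by
  refine LinearIndependent.pair_iff.2 fun s t hst => ?_
  have h0 : s * -y 1 + t * w 0 = 0 := by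
    simpa [rotVec₃] using congrArg (fun v : E3 => v 0) hst
  have h1 : s * y 0 + t * w 1 = 0 := by
    simpa [rotVec₃] using congrArg (fun v : E3 => v 1) hst
  have h2 : t * w 2 = 0 := by
    simpa [rotVec₃] using congrArg (fun v : E3 => v 2) hst
  have ht : t = 0 := (mul_eq_zero.1 h2).resolve_right hw
  subst ht
  have hs : s ^ 2 * (y 0 ^ 2 + y 1 ^ 2) = 0 := by
    linear_combination (s * y 0) * h1 + (-(s * y 1)) * h0
  have := (mul_eq_zero.1 hs).resolve_right hy
  exact ⟨by simpa using this, rfl⟩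

/-- `y₀² + y₁² = 4 |z|² |u|² / N²` for `y = (V/N)(p)`: the image of `p` lies on the vertical axis
iff `z = 0` or `u = 0`. [folklore] -/
theorem mapE_horiz_sq (p : E5) :
    mapE ρ p 0 ^ 2 + mapE ρ p 1 ^ 2 = (nrm ρ p)⁻¹ ^ 2 * (4 * zsq p * (reU ρ p ^ 2 + p 0 ^ 2)) := by
  rw [mapE_apply, mapE_apply, hopfV_apply_zero, hopfV_apply_one]
  unfold zsq
  ring

/-! ### The regular points: every point off the circle `Z = {x₀ = 0, w = 0}` -/

/-- **Off the circle `Z = {x₀ = x₃ = x₄ = 0}` the map `f` is a submersion.**  Four cases: over the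
south pole (`z = 0`, tangent vectors `e₁, e₂`), over the north pole (`u = 0`, tangent vectors `e₀`
and the radial exchange `vB`), and the generic points, where the infinitesimal `z`-rotation is
mapped to the (non-zero) infinitesimal rotation of the target and a radial-exchange vector moves
the height `y₂`. [folklore] -/
theorem surjective_mfderiv_adkMap (hρ0 : 0 < ρ) (hρ1 : ρ < 1) (p : 𝕊⁴)
    (hp : ¬ ((p : E5) 0 = 0 ∧ (p : E5) 3 = 0 ∧ (p : E5) 4 = 0)) :
    Surjective (mfderiv (𝓡 4) (𝓡 2) (adkMap hρ1.ne) p) := by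
  have hgp : MDifferentiableAt (𝓡 4) (𝓡 2) (adkMap hρ1.ne) p :=
    (contMDiff_adkMap hρ1.ne p).mdifferentiableAt (by simp)
  have hs := sum_sq_eq_one p
  set x : E5 := (p : E5) with hx
  have hN : nrm ρ x ≠ 0 := (nrm_pos hρ1.ne p).ne'
  have hA : HasFDerivAt (mapE ρ) (fderiv ℝ (mapE ρ) x) x :=
    ((contDiffAt_mapE hN).differentiableAt (by simp)).hasFDerivAt
  have hNeq := nrm_eq (ρ := ρ) x
  have hZnn := zsq_nonneg x
  have four : (4 : ℝ) ≠ 0 := by norm_num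
  by_cases hz : zsq x = 0
  · -- over the south pole: `z = 0`
    have h1 : x 1 = 0 := by unfold zsq at hz; nlinarith [sq_nonneg (x 1), sq_nonneg (x 2)]
    have h2 : x 2 = 0 := by unfold zsq at hz; nlinarith [sq_nonneg (x 1), sq_nonneg (x 2)]
    have hV0 : hopfV ρ x 0 = 0 := by rw [hopfV_apply_zero, h1, h2]; ring
    have hV1 : hopfV ρ x 1 = 0 := by rw [hopfV_apply_one, h1, h2]; ring
    have hN' : nrm ρ x = reU ρ x ^ 2 + x 0 ^ 2 := by rw [hNeq, hz, zero_add]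
    refine surjective_mfderiv_of_pair (G := mapE ρ) (fun q => rfl) hgp hA (v₁ := e1) (v₂ := e2)
      (by rw [inner_five]; simpa [e1] using h1) (by rw [inner_five]; simpa [e2] using h2) ?_
    apply linearIndependent_of_minor
    have a0 : fderiv ℝ (mapE ρ) x e1 0 = 2 * reU ρ x / nrm ρ x := by
      rw [fderiv_mapE_e1_zero hN, hV0]; field_simp; ring
    have a1 : fderiv ℝ (mapE ρ) x e1 1 = -(2 * x 0) / nrm ρ x := by
      rw [fderiv_mapE_e1_one hN, hV1]; field_simp; ring
    have b0 : fderiv ℝ (mapE ρ) x e2 0 = 2 * x 0 / nrm ρ x := by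
      rw [fderiv_mapE_e2_zero hN, hV0]; field_simp; ring
    have b1 : fderiv ℝ (mapE ρ) x e2 1 = 2 * reU ρ x / nrm ρ x := by
      rw [fderiv_mapE_e2_one hN, hV1]; field_simp; ring
    rw [a0, a1, b0, b1]
    have : 2 * reU ρ x / nrm ρ x * (2 * reU ρ x / nrm ρ x)
        - -(2 * x 0) / nrm ρ x * (2 * x 0 / nrm ρ x) = 4 / nrm ρ x := by
      field_simp
      rw [hN']
      ring
    rw [this]
    exact div_ne_zero four hN
  · by_cases ht : x 0 = 0 ∧ reU ρ x = 0
    · -- over the north pole: `u = 0`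
      obtain ⟨h0, ha⟩ := ht
      have hV0 : hopfV ρ x 0 = 0 := by rw [hopfV_apply_zero, h0, ha]; ring
      have hV1 : hopfV ρ x 1 = 0 := by rw [hopfV_apply_one, h0, ha]; ring
      have hNz : nrm ρ x = zsq x := by rw [hNeq, h0, ha]; ring
      have hW : wsq x = ρ := by rw [reU_eq] at ha; linarith
      have hzx : zsq x ≠ 0 := hz
      refine surjective_mfderiv_of_pair (G := mapE ρ) (fun q => rfl) hgp hA (v₁ := e0)
        (v₂ := vB x) (by rw [inner_five]; simpa [e0] using h0) (inner_vB x) ?_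
      apply linearIndependent_of_minor
      have a0 : fderiv ℝ (mapE ρ) x e0 0 = 2 * x 2 / zsq x := by
        rw [fderiv_mapE_e0_zero hN, hV0, hNz]; field_simp; ring
      have a1 : fderiv ℝ (mapE ρ) x e0 1 = -(2 * x 1) / zsq x := by
        rw [fderiv_mapE_e0_one hN, hV1, hNz]; field_simp; ring
      have b0 : fderiv ℝ (mapE ρ) x (vB x) 0 = -(4 * ρ * x 1) := by
        rw [fderiv_mapE_vB_zero hN, hV0, hNz, ha, h0, hW]; field_simp; ring
      have b1 : fderiv ℝ (mapE ρ) x (vB x) 1 = -(4 * ρ * x 2) := by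
        rw [fderiv_mapE_vB_one hN, hV1, hNz, ha, h0, hW]; field_simp; ring
      rw [a0, a1, b0, b1]
      have : 2 * x 2 / zsq x * -(4 * ρ * x 2) - -(2 * x 1) / zsq x * -(4 * ρ * x 1) = -(8 * ρ) := by
        field_simp
        unfold zsq
        ring
      rw [this]
      exact neg_ne_zero.2 (mul_ne_zero (by norm_num) hρ0.ne')
    · -- generic points: the image is off the vertical axis
      have hy : mapE ρ x 0 ^ 2 + mapE ρ x 1 ^ 2 ≠ 0 := by
        rw [mapE_horiz_sq]
        have hu : reU ρ x ^ 2 + x 0 ^ 2 ≠ 0 := by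
          intro h
          apply ht
          constructor
          · nlinarith [sq_nonneg (reU ρ x), sq_nonneg (x 0)]
          · nlinarith [sq_nonneg (reU ρ x), sq_nonneg (x 0)]
        refine mul_ne_zero (pow_ne_zero 2 (inv_ne_zero hN)) (mul_ne_zero (mul_ne_zero four hz) hu)
      by_cases h0 : x 0 = 0
      · -- `x₀ = 0`, `a ≠ 0`, `w ≠ 0`: rotation and `vB`
        have ha : reU ρ x ≠ 0 := fun h => ht ⟨h0, h⟩
        have hW : wsq x ≠ 0 := by
          intro hw
          apply hp
          unfold wsq at hw
          refine ⟨h0, ?_, ?_⟩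
          · nlinarith [sq_nonneg (x 3), sq_nonneg (x 4)]
          · nlinarith [sq_nonneg (x 3), sq_nonneg (x 4)]
        have hZW : zsq x + wsq x = 1 := by unfold zsq wsq; rw [h0] at hs; linarith
        have hpos : 0 < reU ρ x + 2 * zsq x := by rw [reU_eq]; linarith
        refine surjective_mfderiv_of_pair (G := mapE ρ) (fun q => rfl) hgp hA (v₁ := rotVec x)
          (v₂ := vB x) (inner_rotVec x) (inner_vB x) ?_
        rw [fderiv_mapE_rotVec hN]
        apply linearIndependent_rotVec₃ hy
        have hval : fderiv ℝ (mapE ρ) x (vB x) 2 =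
            4 * zsq x * wsq x * reU ρ x * (reU ρ x + 2 * zsq x) / nrm ρ x ^ 2 := by
          rw [fderiv_mapE_vB_two hN, hopfV_apply_two, hNeq, h0]
          unfold zsq
          field_simp
          ring
        rw [hval]
        exact div_ne_zero (mul_ne_zero (mul_ne_zero (mul_ne_zero (mul_ne_zero four hz) hW) ha)
          hpos.ne') (pow_ne_zero 2 hN)
      · -- `x₀ ≠ 0`: rotation and `vA`
        refine surjective_mfderiv_of_pair (G := mapE ρ) (fun q => rfl) hgp hA (v₁ := rotVec x)
          (v₂ := vA x) (inner_rotVec x) (inner_vA x) ?_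
        rw [fderiv_mapE_rotVec hN]
        apply linearIndependent_rotVec₃ hy
        rw [fderiv_mapE_vA_two hN]
        exact div_ne_zero (neg_ne_zero.2 (mul_ne_zero (mul_ne_zero four hz) h0)) hN


/-! ### Fold coordinates near the critical circle -/

/-- Derivative at `0` of a real function which is a quotient of quartics along the line.
[folklore] -/
theorem hasDerivAt_of_eq_quartic_div {F : ℝ → ℝ} (q₀ q₁ q₂ q₃ q₄ d₀ d₁ d₂ d₃ d₄ : ℝ)
    (hF : ∀ t : ℝ, F t = (q₀ + q₁ * t + q₂ * t ^ 2 + q₃ * t ^ 3 + q₄ * t ^ 4) /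
      (d₀ + d₁ * t + d₂ * t ^ 2 + d₃ * t ^ 3 + d₄ * t ^ 4)) (hd₀ : d₀ ≠ 0) :
    HasDerivAt F ((q₁ * d₀ - q₀ * d₁) / d₀ ^ 2) 0 := by
  rw [show F = _ from funext hF]
  have h := (hasDerivAt_quartic q₀ q₁ q₂ q₃ q₄).div (hasDerivAt_quartic d₀ d₁ d₂ d₃ d₄)
    (by simpa using hd₀)
  refine h.congr_deriv ?_
  simp

/-- A directional derivative of a component of a differentiable map into `ℝⁿ`, computed along a
line, is the corresponding entry of the Jacobian. [folklore] -/
theorem fderiv_apply_eq_of_line {F : Type*} [NormedAddCommGroup F] [NormedSpace ℝ F] {n : ℕ}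
    {G : F → EuclideanSpace ℝ (Fin n)} {p v : F} (hG : DifferentiableAt ℝ G p) {i : Fin n} {c : ℝ}
    (h : HasDerivAt (fun t : ℝ => G (p + t • v) i) c 0) : fderiv ℝ G p v i = c := by
  have hA : HasFDerivAt G (fderiv ℝ G p) (p + (0 : ℝ) • v) := by
    rw [zero_smul, add_zero]; exact hG.hasFDerivAt
  have hl : HasDerivAt (fun t : ℝ => p + t • v) v 0 := by
    simpa using ((hasDerivAt_id (0 : ℝ)).smul_const v).const_add p
  have hc := hA.comp_hasDerivAt (0 : ℝ) hl
  have hi : HasDerivAt ((EuclideanSpace.proj i) ∘ (G ∘ fun t : ℝ => p + t • v))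
      ((EuclideanSpace.proj i) (fderiv ℝ G p v)) 0 :=
    ((EuclideanSpace.proj i).hasFDerivAt).comp_hasDerivAt (0 : ℝ) hc
  exact hi.unique h

/-- **Target fold coordinates** near the critical value attached to the point `(0, c₁, c₂, 0, 0)`
of the critical circle: `Ψ(y) = (y₁ c₁ - y₀ c₂, ρ² - (1 - y₂)/(1 + y₂))` (an angular coordinate
along the latitude circles and a function of the height). [folklore] -/
def psiE (ρ c₁ c₂ : ℝ) (y : E3) : E2 :=
  WithLp.toLp 2 ![y 1 * c₁ - y 0 * c₂, ρ ^ 2 - (1 - y 2) / (1 + y 2)]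

/-- First target fold coordinate. [folklore] -/
@[simp] theorem psiE_apply_zero (c₁ c₂ : ℝ) (y : E3) : psiE ρ c₁ c₂ y 0 = y 1 * c₁ - y 0 * c₂ := by
  simp [psiE]

/-- Second target fold coordinate. [folklore] -/
@[simp] theorem psiE_apply_one (c₁ c₂ : ℝ) (y : E3) :
    psiE ρ c₁ c₂ y 1 = ρ ^ 2 - (1 - y 2) / (1 + y 2) := by
  simp [psiE]

/-- The target fold coordinates are smooth off the plane `y₂ = -1`. [folklore] -/
theorem contDiffAt_psiE (c₁ c₂ : ℝ) {y : E3} (hy : 1 + y 2 ≠ 0) : ContDiffAt ℝ ∞ (psiE ρ c₁ c₂) y := by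
  rw [contDiffAt_euclidean]
  intro i
  fin_cases i
  · simp only [Fin.zero_eta, psiE_apply_zero]
    fun_prop
  · simp only [Fin.mk_one, psiE_apply_one]
    refine contDiffAt_const.sub (ContDiffAt.div (by fun_prop) (by fun_prop) hy)

/-- The square-root rescaling `S = √((2ρ - ρ² - |w|²)/|z|²)`. [folklore] -/
def sFun (ρ : ℝ) (x : E5) : ℝ := Real.sqrt ((2 * ρ - ρ ^ 2 - wsq x) / zsq x)

/-- The square-root rescaling `S' = √((1 + ρ²)/|z|²)`. [folklore] -/
def sFun' (ρ : ℝ) (x : E5) : ℝ := Real.sqrt ((1 + ρ ^ 2) / zsq x)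

/-- **Source fold coordinates** near the point `(0, c₁, c₂, 0, 0)` of the critical circle:
`Φ(x) = (Ψ₀(f x), x₃ S, x₄ S, x₀ S')`. [folklore] -/
def phiE (ρ c₁ c₂ : ℝ) (x : E5) : E4 :=
  WithLp.toLp 2 ![psiE ρ c₁ c₂ (mapE ρ x) 0, x 3 * sFun ρ x, x 4 * sFun ρ x, x 0 * sFun' ρ x]

/-- First source fold coordinate. [folklore] -/
@[simp] theorem phiE_apply_zero (c₁ c₂ : ℝ) (x : E5) :
    phiE ρ c₁ c₂ x 0 = mapE ρ x 1 * c₁ - mapE ρ x 0 * c₂ := by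
  simp [phiE]

/-- Second source fold coordinate. [folklore] -/
@[simp] theorem phiE_apply_one (c₁ c₂ : ℝ) (x : E5) : phiE ρ c₁ c₂ x 1 = x 3 * sFun ρ x := by
  simp [phiE]

/-- Third source fold coordinate. [folklore] -/
@[simp] theorem phiE_apply_two (c₁ c₂ : ℝ) (x : E5) : phiE ρ c₁ c₂ x 2 = x 4 * sFun ρ x := by
  simp [phiE]

/-- Fourth source fold coordinate. [folklore] -/
@[simp] theorem phiE_apply_three (c₁ c₂ : ℝ) (x : E5) : phiE ρ c₁ c₂ x 3 = x 0 * sFun' ρ x := by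
  simp [phiE]

/-- `|z|²` is smooth. [folklore] -/
theorem contDiff_zsq : ContDiff ℝ ∞ zsq := by unfold zsq; fun_prop

/-- `|w|²` is smooth. [folklore] -/
theorem contDiff_wsq : ContDiff ℝ ∞ wsq := by unfold wsq; fun_prop

/-- `S` is smooth where its radicand is positive. [folklore] -/
theorem contDiffAt_sFun {x : E5} (hz : 0 < zsq x) (hw : 0 < 2 * ρ - ρ ^ 2 - wsq x) :
    ContDiffAt ℝ ∞ (sFun ρ) x := by
  unfold sFun
  refine (Real.contDiffAt_sqrt (div_pos hw hz).ne').comp x ?_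
  exact (contDiffAt_const.sub contDiff_wsq.contDiffAt).div contDiff_zsq.contDiffAt hz.ne'

/-- `S'` is smooth where `z ≠ 0`. [folklore] -/
theorem contDiffAt_sFun' {x : E5} (hz : 0 < zsq x) : ContDiffAt ℝ ∞ (sFun' ρ) x := by
  unfold sFun'
  refine (Real.contDiffAt_sqrt (div_pos (by positivity) hz).ne').comp x ?_
  exact contDiffAt_const.div contDiff_zsq.contDiffAt hz.ne'

/-- `1 + y₂ = 2|z|²/N` for `y = (V/N)(x)`. [folklore] -/
theorem one_add_mapE_two {x : E5} (hN : nrm ρ x ≠ 0) : 1 + mapE ρ x 2 = 2 * zsq x / nrm ρ x := by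
  rw [mapE_apply, hopfV_apply_two, nrm_eq]
  rw [nrm_eq] at hN
  unfold zsq at hN ⊢
  field_simp
  ring

/-- `1 - y₂ = 2|u|²/N` for `y = (V/N)(x)`. [folklore] -/
theorem one_sub_mapE_two {x : E5} (hN : nrm ρ x ≠ 0) :
    1 - mapE ρ x 2 = 2 * (reU ρ x ^ 2 + x 0 ^ 2) / nrm ρ x := by
  rw [mapE_apply, hopfV_apply_two, nrm_eq]
  rw [nrm_eq] at hN
  unfold zsq at hN ⊢
  field_simp
  ring

/-- The source fold coordinates are smooth on the fold domain. [folklore] -/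
theorem contDiffAt_phiE (c₁ c₂ : ℝ) {x : E5} (hN : nrm ρ x ≠ 0) (hz : 0 < zsq x)
    (hw : 0 < 2 * ρ - ρ ^ 2 - wsq x) : ContDiffAt ℝ ∞ (phiE ρ c₁ c₂) x := by
  have hy : 1 + mapE ρ x 2 ≠ 0 := by
    rw [one_add_mapE_two hN]
    exact div_ne_zero (mul_ne_zero two_ne_zero hz.ne') hN
  have hm : ContDiffAt ℝ ∞ (mapE ρ) x := contDiffAt_mapE hN
  have h0 : ContDiffAt ℝ ∞ (fun x => mapE ρ x 0) x := contDiffAt_euclidean.1 hm 0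
  have h1 : ContDiffAt ℝ ∞ (fun x => mapE ρ x 1) x := contDiffAt_euclidean.1 hm 1
  rw [contDiffAt_euclidean]
  intro i
  fin_cases i
  · simp only [Fin.zero_eta, phiE_apply_zero]
    exact (h1.mul contDiffAt_const).sub (h0.mul contDiffAt_const)
  · simp only [Fin.mk_one, phiE_apply_one]
    exact (EuclideanSpace.proj (3 : Fin 5)).contDiff.contDiffAt.mul (contDiffAt_sFun hz hw)
  · simp only [Fin.reduceFinMk, phiE_apply_two]
    exact (EuclideanSpace.proj (4 : Fin 5)).contDiff.contDiffAt.mul (contDiffAt_sFun hz hw)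
  · simp only [Fin.reduceFinMk, phiE_apply_three]
    exact (EuclideanSpace.proj (0 : Fin 5)).contDiff.contDiffAt.mul (contDiffAt_sFun' hz)

/-- **The fold identity**: `Ψ₁(f q) = Φ₁(q)² + Φ₂(q)² - Φ₃(q)²` on the sphere, where the square
roots are defined. [folklore] -/
theorem psiE_mapE_one_eq (hρ1 : ρ ≠ 1) (c₁ c₂ : ℝ) (q : 𝕊⁴) (hz : 0 < zsq (q : E5))
    (hw : 0 < 2 * ρ - ρ ^ 2 - wsq (q : E5)) :
    psiE ρ c₁ c₂ (mapE ρ (q : E5)) 1 =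
      phiE ρ c₁ c₂ (q : E5) 1 ^ 2 + phiE ρ c₁ c₂ (q : E5) 2 ^ 2 - phiE ρ c₁ c₂ (q : E5) 3 ^ 2 := by
  have hN : nrm ρ (q : E5) ≠ 0 := (nrm_pos hρ1 q).ne'
  have hs := sum_sq_eq_one q
  set x : E5 := (q : E5)
  have hZ : zsq x = 1 - x 0 ^ 2 - wsq x := by unfold zsq wsq; linarith
  rw [psiE_apply_one, phiE_apply_one, phiE_apply_two, phiE_apply_three, one_sub_mapE_two hN,
    one_add_mapE_two hN, mul_pow, mul_pow, mul_pow, sFun, sFun',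
    Real.sq_sqrt (div_pos hw hz).le, Real.sq_sqrt (div_pos (by positivity) hz).le, reU_eq]
  have hz' : zsq x ≠ 0 := hz.ne'
  field_simp
  rw [hZ] at hz' ⊢
  unfold wsq
  ring


/-! ### Points of the critical circle `Z = {x₀ = 0, w = 0}` -/

section OnZ

variable {P : E5}

/-- On the critical circle `|z|² = 1`. [folklore] -/
theorem zsq_of_memZ (hs : P 0 ^ 2 + P 1 ^ 2 + P 2 ^ 2 + P 3 ^ 2 + P 4 ^ 2 = 1) (h0 : P 0 = 0)
    (h3 : P 3 = 0) (h4 : P 4 = 0) : zsq P = 1 := by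
  unfold zsq; rw [h0, h3, h4] at hs; linarith

/-- On the critical circle `|w|² = 0`. [folklore] -/
theorem wsq_of_memZ (h3 : P 3 = 0) (h4 : P 4 = 0) : wsq P = 0 := by
  unfold wsq; rw [h3, h4]; ring

/-- On the critical circle `Re u = -ρ`. [folklore] -/
theorem reU_of_memZ (h3 : P 3 = 0) (h4 : P 4 = 0) : reU ρ P = -ρ := by
  rw [reU_eq, wsq_of_memZ h3 h4]; ring

/-- On the critical circle `N = 1 + ρ²`. [folklore] -/
theorem nrm_of_memZ (hs : P 0 ^ 2 + P 1 ^ 2 + P 2 ^ 2 + P 3 ^ 2 + P 4 ^ 2 = 1) (h0 : P 0 = 0)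
    (h3 : P 3 = 0) (h4 : P 4 = 0) : nrm ρ P = 1 + ρ ^ 2 := by
  rw [nrm_eq, zsq_of_memZ hs h0 h3 h4, reU_of_memZ h3 h4, h0]; ring

/-- On the critical circle `f₀ = -2ρ x₁/(1 + ρ²)`. [folklore] -/
theorem mapE_of_memZ_zero (hs : P 0 ^ 2 + P 1 ^ 2 + P 2 ^ 2 + P 3 ^ 2 + P 4 ^ 2 = 1) (h0 : P 0 = 0)
    (h3 : P 3 = 0) (h4 : P 4 = 0) : mapE ρ P 0 = -(2 * ρ * P 1) / (1 + ρ ^ 2) := by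
  rw [mapE_apply, nrm_of_memZ hs h0 h3 h4, hopfV_apply_zero, reU_of_memZ h3 h4, h0]
  field_simp
  ring

/-- On the critical circle `f₁ = -2ρ x₂/(1 + ρ²)`. [folklore] -/
theorem mapE_of_memZ_one (hs : P 0 ^ 2 + P 1 ^ 2 + P 2 ^ 2 + P 3 ^ 2 + P 4 ^ 2 = 1) (h0 : P 0 = 0)
    (h3 : P 3 = 0) (h4 : P 4 = 0) : mapE ρ P 1 = -(2 * ρ * P 2) / (1 + ρ ^ 2) := by
  rw [mapE_apply, nrm_of_memZ hs h0 h3 h4, hopfV_apply_one, reU_of_memZ h3 h4, h0]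
  field_simp
  ring

/-- On the critical circle `f₂ = (1 - ρ²)/(1 + ρ²)`, the critical height. [folklore] -/
theorem mapE_of_memZ_two (hs : P 0 ^ 2 + P 1 ^ 2 + P 2 ^ 2 + P 3 ^ 2 + P 4 ^ 2 = 1) (h0 : P 0 = 0)
    (h3 : P 3 = 0) (h4 : P 4 = 0) : mapE ρ P 2 = (1 - ρ ^ 2) / (1 + ρ ^ 2) := by
  rw [mapE_apply, nrm_of_memZ hs h0 h3 h4, hopfV_apply_two, reU_of_memZ h3 h4, h0]
  have hz := zsq_of_memZ hs h0 h3 h4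
  unfold zsq at hz
  field_simp
  linear_combination hz

end OnZ

/-! ### The Jacobians of the fold coordinates at the base point -/

/-- `(DΨ_y v)₀ = v₁ c₁ - v₀ c₂`. [folklore] -/
theorem fderiv_psiE_apply_zero (c₁ c₂ : ℝ) {y : E3} (v : E3) (hy : 1 + y 2 ≠ 0) :
    fderiv ℝ (psiE ρ c₁ c₂) y v 0 = v 1 * c₁ - v 0 * c₂ := by
  refine fderiv_apply_eq_of_line ((contDiffAt_psiE c₁ c₂ hy).differentiableAt (by simp)) ?_
  have h := hasDerivAt_of_eq_quartic_div (F := fun t : ℝ => psiE ρ c₁ c₂ (y + t • v) 0)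
    (y 1 * c₁ - y 0 * c₂) (v 1 * c₁ - v 0 * c₂) 0 0 0 1 0 0 0 0
    (fun t => by simp [psiE]; ring) one_ne_zero
  exact h.congr_deriv (by ring)

/-- `(DΨ_y v)₁ = 2 v₂ / (1 + y₂)²`. [folklore] -/
theorem fderiv_psiE_apply_one (c₁ c₂ : ℝ) {y : E3} (v : E3) (hy : 1 + y 2 ≠ 0) :
    fderiv ℝ (psiE ρ c₁ c₂) y v 1 = 2 * v 2 / (1 + y 2) ^ 2 := by
  refine fderiv_apply_eq_of_line ((contDiffAt_psiE c₁ c₂ hy).differentiableAt (by simp)) ?_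
  -- away from `1 + y₂ + t v₂ = 0` the function is an explicit quotient of affine functions
  have hev : ∀ᶠ t : ℝ in 𝓝 0, 1 + y 2 + t * v 2 ≠ 0 := by
    have hc : ContinuousAt (fun t : ℝ => 1 + y 2 + t * v 2) 0 := by fun_prop
    exact hc.eventually_ne (by simpa using hy)
  have h := (hasDerivAt_quartic (ρ ^ 2 * (1 + y 2) - (1 - y 2)) ((1 + ρ ^ 2) * v 2) 0 0 0).div
    (hasDerivAt_quartic (1 + y 2) (v 2) 0 0 0) (by simpa using hy)
  refine (h.congr_of_eventuallyEq (hev.mono fun t ht => ?_)).congr_deriv ?_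
  · simp only [psiE_apply_one, PiLp.add_apply, PiLp.smul_apply, smul_eq_mul, Pi.div_apply,
      zero_mul, add_zero]
    have h2 : 1 + y 2 + v 2 * t ≠ 0 := by rwa [mul_comm] at ht
    have heq : 1 + (y 2 + t * v 2) = 1 + y 2 + v 2 * t := by ring
    rw [heq]
    field_simp
    ring
  · simp only [mul_zero, add_zero, zero_mul]
    field_simp
    ring

/-- The components of `V/N` along a line through `p` have the Jacobian entries as derivatives.
[folklore] -/
theorem hasDerivAt_mapE_line_apply {p : E5} (hp : nrm ρ p ≠ 0) (v : E5) (i : Fin 3) :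
    HasDerivAt (fun t : ℝ => mapE ρ (p + t • v) i) (fderiv ℝ (mapE ρ) p v i) 0 := by
  have hl : HasDerivAt (fun t : ℝ => p + t • v) v 0 := by
    simpa using ((hasDerivAt_id (0 : ℝ)).smul_const v).const_add p
  have hc := hasDerivAt_mapE_comp hp (γ := fun t : ℝ => p + t • v) (by simp) hl
  exact ((EuclideanSpace.proj i).hasFDerivAt).comp_hasDerivAt (0 : ℝ) hc

/-- `(DΦ_p v)₀ = (D(V/N)_p v)₁ c₁ - (D(V/N)_p v)₀ c₂`. [folklore] -/
theorem fderiv_phiE_apply_zero (c₁ c₂ : ℝ) {p : E5} (hN : nrm ρ p ≠ 0) (hz : 0 < zsq p)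
    (hw : 0 < 2 * ρ - ρ ^ 2 - wsq p) (v : E5) :
    fderiv ℝ (phiE ρ c₁ c₂) p v 0 =
      fderiv ℝ (mapE ρ) p v 1 * c₁ - fderiv ℝ (mapE ρ) p v 0 * c₂ := by
  refine fderiv_apply_eq_of_line ((contDiffAt_phiE c₁ c₂ hN hz hw).differentiableAt (by simp)) ?_
  simp only [phiE_apply_zero]
  exact ((hasDerivAt_mapE_line_apply hN v 1).mul_const c₁).sub
    ((hasDerivAt_mapE_line_apply hN v 0).mul_const c₂)

/-- `(DΦ_p v)₁ = v₃ S(p)` at a point with `x₃ = 0`. [folklore] -/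
theorem fderiv_phiE_apply_one (c₁ c₂ : ℝ) {p : E5} (hN : nrm ρ p ≠ 0) (hz : 0 < zsq p)
    (hw : 0 < 2 * ρ - ρ ^ 2 - wsq p) (h3 : p 3 = 0) (v : E5) :
    fderiv ℝ (phiE ρ c₁ c₂) p v 1 = v 3 * sFun ρ p := by
  refine fderiv_apply_eq_of_line ((contDiffAt_phiE c₁ c₂ hN hz hw).differentiableAt (by simp)) ?_
  simp only [phiE_apply_one, PiLp.add_apply, PiLp.smul_apply, smul_eq_mul]
  have hl : HasDerivAt (fun t : ℝ => p + t • v) v 0 := by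
    simpa using ((hasDerivAt_id (0 : ℝ)).smul_const v).const_add p
  have hS : HasDerivAt (fun t : ℝ => sFun ρ (p + t • v)) (fderiv ℝ (sFun ρ) p v) 0 := by
    have hd : HasFDerivAt (sFun ρ) (fderiv ℝ (sFun ρ) p) (p + (0 : ℝ) • v) := by
      rw [zero_smul, add_zero]
      exact ((contDiffAt_sFun hz hw).differentiableAt (by simp)).hasFDerivAt
    exact hd.comp_hasDerivAt (0 : ℝ) hl
  have h1 : HasDerivAt (fun t : ℝ => p 3 + t * v 3) (v 3) 0 := by
    simpa using ((hasDerivAt_id (0 : ℝ)).mul_const (v 3)).const_add (p 3)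
  refine (h1.mul hS).congr_deriv ?_
  simp [h3]

/-- `(DΦ_p v)₂ = v₄ S(p)` at a point with `x₄ = 0`. [folklore] -/
theorem fderiv_phiE_apply_two (c₁ c₂ : ℝ) {p : E5} (hN : nrm ρ p ≠ 0) (hz : 0 < zsq p)
    (hw : 0 < 2 * ρ - ρ ^ 2 - wsq p) (h4 : p 4 = 0) (v : E5) :
    fderiv ℝ (phiE ρ c₁ c₂) p v 2 = v 4 * sFun ρ p := by
  refine fderiv_apply_eq_of_line ((contDiffAt_phiE c₁ c₂ hN hz hw).differentiableAt (by simp)) ?_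
  simp only [phiE_apply_two, PiLp.add_apply, PiLp.smul_apply, smul_eq_mul]
  have hl : HasDerivAt (fun t : ℝ => p + t • v) v 0 := by
    simpa using ((hasDerivAt_id (0 : ℝ)).smul_const v).const_add p
  have hS : HasDerivAt (fun t : ℝ => sFun ρ (p + t • v)) (fderiv ℝ (sFun ρ) p v) 0 := by
    have hd : HasFDerivAt (sFun ρ) (fderiv ℝ (sFun ρ) p) (p + (0 : ℝ) • v) := by
      rw [zero_smul, add_zero]
      exact ((contDiffAt_sFun hz hw).differentiableAt (by simp)).hasFDerivAt
    exact hd.comp_hasDerivAt (0 : ℝ) hl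
  have h1 : HasDerivAt (fun t : ℝ => p 4 + t * v 4) (v 4) 0 := by
    simpa using ((hasDerivAt_id (0 : ℝ)).mul_const (v 4)).const_add (p 4)
  refine (h1.mul hS).congr_deriv ?_
  simp [h4]

/-- `(DΦ_p v)₃ = v₀ S'(p)` at a point with `x₀ = 0`. [folklore] -/
theorem fderiv_phiE_apply_three (c₁ c₂ : ℝ) {p : E5} (hN : nrm ρ p ≠ 0) (hz : 0 < zsq p)
    (hw : 0 < 2 * ρ - ρ ^ 2 - wsq p) (h0 : p 0 = 0) (v : E5) :
    fderiv ℝ (phiE ρ c₁ c₂) p v 3 = v 0 * sFun' ρ p := by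
  refine fderiv_apply_eq_of_line ((contDiffAt_phiE c₁ c₂ hN hz hw).differentiableAt (by simp)) ?_
  simp only [phiE_apply_three, PiLp.add_apply, PiLp.smul_apply, smul_eq_mul]
  have hl : HasDerivAt (fun t : ℝ => p + t • v) v 0 := by
    simpa using ((hasDerivAt_id (0 : ℝ)).smul_const v).const_add p
  have hS : HasDerivAt (fun t : ℝ => sFun' ρ (p + t • v)) (fderiv ℝ (sFun' ρ) p v) 0 := by
    have hd : HasFDerivAt (sFun' ρ) (fderiv ℝ (sFun' ρ) p) (p + (0 : ℝ) • v) := by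
      rw [zero_smul, add_zero]
      exact ((contDiffAt_sFun' hz).differentiableAt (by simp)).hasFDerivAt
    exact hd.comp_hasDerivAt (0 : ℝ) hl
  have h1 : HasDerivAt (fun t : ℝ => p 0 + t * v 0) (v 0) 0 := by
    simpa using ((hasDerivAt_id (0 : ℝ)).mul_const (v 0)).const_add (p 0)
  refine (h1.mul hS).congr_deriv ?_
  simp [h0]

/-! ### The kernels at a point of the critical circle -/

section Kernels

variable {P : E5} (hρ0 : 0 < ρ) (hρ1 : ρ < 1)
  (hs : P 0 ^ 2 + P 1 ^ 2 + P 2 ^ 2 + P 3 ^ 2 + P 4 ^ 2 = 1) (h0 : P 0 = 0) (h3 : P 3 = 0)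
  (h4 : P 4 = 0)
include hρ0 hρ1 hs h0 h3 h4

omit hρ0 hρ1 in
/-- A tangent vector at a point of `Z` with vanishing `x₀, x₃, x₄`-components is a multiple of the
infinitesimal rotation. [folklore] -/
theorem eq_smul_rotVec_of_memZ {v : E5} (hv : inner ℝ P v = 0) (hv0 : v 0 = 0) (hv3 : v 3 = 0)
    (hv4 : v 4 = 0) : v = (P 1 * v 2 - P 2 * v 1) • rotVec P := by
  have hz := zsq_of_memZ hs h0 h3 h4
  unfold zsq at hz
  rw [inner_five, h0, h3, h4] at hv
  ext i
  fin_cases i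
  · simp [rotVec, hv0]
  · simp only [Fin.mk_one, rotVec, PiLp.smul_apply, smul_eq_mul]
    simp
    linear_combination (-(v 1)) * hz + P 1 * hv
  · simp only [Fin.reduceFinMk, rotVec, PiLp.smul_apply, smul_eq_mul]
    simp
    linear_combination (-(v 2)) * hz + P 2 * hv
  · simp [rotVec, hv3]
  · simp [rotVec, hv4]

/-- **The source fold coordinates have injective differential along the sphere** at the base
point: a tangent vector killed by `DΦ_P` vanishes. [folklore] -/
theorem eq_zero_of_fderiv_phiE_eq_zero {v : E5} (hv : inner ℝ P v = 0)
    (hB : fderiv ℝ (phiE ρ (P 1) (P 2)) P v = 0) : v = 0 := by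
  have hz1 := zsq_of_memZ hs h0 h3 h4
  have hN : nrm ρ P ≠ 0 := by rw [nrm_of_memZ hs h0 h3 h4]; positivity
  have hz : 0 < zsq P := by rw [hz1]; exact one_pos
  have hw : 0 < 2 * ρ - ρ ^ 2 - wsq P := by rw [wsq_of_memZ h3 h4]; nlinarith
  have hS : 0 < sFun ρ P := Real.sqrt_pos.2 (div_pos hw hz)
  have hS' : 0 < sFun' ρ P := Real.sqrt_pos.2 (div_pos (by positivity) hz)
  have hv3 : v 3 = 0 := by
    have := congrArg (fun w : E4 => w 1) hB
    simp only [fderiv_phiE_apply_one _ _ hN hz hw h3, PiLp.zero_apply] at this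
    exact (mul_eq_zero.1 this).resolve_right hS.ne'
  have hv4 : v 4 = 0 := by
    have := congrArg (fun w : E4 => w 2) hB
    simp only [fderiv_phiE_apply_two _ _ hN hz hw h4, PiLp.zero_apply] at this
    exact (mul_eq_zero.1 this).resolve_right hS.ne'
  have hv0 : v 0 = 0 := by
    have := congrArg (fun w : E4 => w 3) hB
    simp only [fderiv_phiE_apply_three _ _ hN hz hw h0, PiLp.zero_apply] at this
    exact (mul_eq_zero.1 this).resolve_right hS'.ne'
  set β := P 1 * v 2 - P 2 * v 1 with hβ
  have hvβ : v = β • rotVec P := eq_smul_rotVec_of_memZ hs h0 h3 h4 hv hv0 hv3 hv4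
  have hc := congrArg (fun w : E4 => w 0) hB
  simp only [fderiv_phiE_apply_zero _ _ hN hz hw, PiLp.zero_apply] at hc
  rw [hvβ, map_smul, fderiv_mapE_rotVec hN] at hc
  simp [rotVec₃] at hc
  rw [mapE_of_memZ_zero hs h0 h3 h4, mapE_of_memZ_one hs h0 h3 h4] at hc
  have hz' := hz1
  unfold zsq at hz'
  have hβ0 : β * (2 * ρ) / (1 + ρ ^ 2) = 0 := by
    have h1 : (1 : ℝ) + ρ ^ 2 ≠ 0 := by positivity
    field_simp at hc
    field_simp
    linear_combination (-1 : ℝ) * hc - 2 * ρ * β * hz'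
  have hβz : β = 0 := by
    have h1 : (2 : ℝ) * ρ / (1 + ρ ^ 2) ≠ 0 := by positivity
    have : β * (2 * ρ / (1 + ρ ^ 2)) = 0 := by rw [← mul_div_assoc]; exact hβ0
    exact (mul_eq_zero.1 this).resolve_right h1
  rw [hvβ, hβz, zero_smul]

omit hρ1 in
/-- **The target fold coordinates have injective differential along the sphere** at the critical
value: a tangent vector at `f(P)` killed by `DΨ` vanishes. [folklore] -/
theorem eq_zero_of_fderiv_psiE_eq_zero {v : E3} (hv : inner ℝ (mapE ρ P) v = 0)
    (hB : fderiv ℝ (psiE ρ (P 1) (P 2)) (mapE ρ P) v = 0) : v = 0 := by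
  have hz1 := zsq_of_memZ hs h0 h3 h4
  have hy2 := mapE_of_memZ_two (ρ := ρ) hs h0 h3 h4
  have hy : 1 + mapE ρ P 2 ≠ 0 := by
    rw [hy2, show (1 : ℝ) + (1 - ρ ^ 2) / (1 + ρ ^ 2) = 2 / (1 + ρ ^ 2) by field_simp; ring]
    positivity
  have hc0 := congrArg (fun w : E2 => w 0) hB
  have hc1 := congrArg (fun w : E2 => w 1) hB
  simp only [fderiv_psiE_apply_zero _ _ v hy, PiLp.zero_apply] at hc0
  simp only [fderiv_psiE_apply_one _ _ v hy, PiLp.zero_apply] at hc1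
  have hv2 : v 2 = 0 := by
    rcases div_eq_zero_iff.1 hc1 with h | h
    · linarith
    · exact absurd ((pow_eq_zero_iff two_ne_zero).1 h) hy
  rw [inner_three, mapE_of_memZ_zero hs h0 h3 h4, mapE_of_memZ_one hs h0 h3 h4, hv2,
    mul_zero, add_zero] at hv
  have h1 : (1 : ℝ) + ρ ^ 2 ≠ 0 := by positivity
  have hlin : P 1 * v 0 + P 2 * v 1 = 0 := by
    field_simp at hv
    have : ρ * (P 1 * v 0 + P 2 * v 1) = 0 := by linear_combination (-1/2 : ℝ) * hv
    exact (mul_eq_zero.1 this).resolve_left hρ0.ne'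
  unfold zsq at hz1
  have hv0 : v 0 = 0 := by
    linear_combination (-(v 0)) * hz1 + P 1 * hlin - P 2 * hc0
  have hv1 : v 1 = 0 := by
    linear_combination (-(v 1)) * hz1 + P 2 * hlin + P 1 * hc0
  ext i
  fin_cases i
  · simpa using hv0
  · simpa using hv1
  · simpa using hv2

end Kernels


/-! ### The fold charts -/

/-- **Inverse function theorem on a sphere, injective form**: a map from the round `n`-sphere to
`ℝⁿ`, smooth on an open set around `p` and with injective differential at `p`, is a local
diffeomorphism at `p` (dimension count, then the tree's manifold inverse function theorem
`Literature.Geometry.Manifold.isLocalDiffeomorphAt_of_mfderiv`). [cite: LeeSmoothManifolds2013, Thm. 4.5] -/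
theorem isLocalDiffeomorphAt_sphere_of_injective {n : ℕ} {E : Type*} [NormedAddCommGroup E]
    [InnerProductSpace ℝ E] [Fact (Module.finrank ℝ E = n + 1)]
    {g : sphere (0 : E) 1 → EuclideanSpace ℝ (Fin n)} {p : sphere (0 : E) 1}
    {U : Set (sphere (0 : E) 1)} (hU : IsOpen U) (hp : p ∈ U)
    (hg : ContMDiffOn (𝓡 n) (𝓡 n) ∞ g U) (hinj : Injective (mfderiv (𝓡 n) (𝓡 n) g p)) :
    IsLocalDiffeomorphAt (𝓡 n) (𝓡 n) ∞ g p := by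
  obtain ⟨D, hD⟩ : ∃ D : EuclideanSpace ℝ (Fin n) →L[ℝ] EuclideanSpace ℝ (Fin n),
      mfderiv (𝓡 n) (𝓡 n) g p = D := ⟨_, rfl⟩
  have hinj' : Injective D := hD ▸ hinj
  set L : EuclideanSpace ℝ (Fin n) ≃ₗ[ℝ] EuclideanSpace ℝ (Fin n) :=
    LinearMap.linearEquivOfInjective (D : EuclideanSpace ℝ (Fin n) →ₗ[ℝ] EuclideanSpace ℝ (Fin n))
      hinj' rfl
  refine Literature.Geometry.Manifold.isLocalDiffeomorphAt_of_mfderiv (by simp) hU hp hg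
    L.toContinuousLinearEquiv ?_
  rw [hD]
  ext v
  rfl

/-- The open set of the source where the fold coordinates are smooth. [folklore] -/
def foldDom (ρ : ℝ) : Set 𝕊⁴ := {q | 0 < zsq (q : E5) ∧ 0 < 2 * ρ - ρ ^ 2 - wsq (q : E5)}

/-- The fold domain is open. [folklore] -/
theorem isOpen_foldDom : IsOpen (foldDom ρ) := by
  refine IsOpen.inter ?_ ?_
  · exact isOpen_lt continuous_const (contDiff_zsq.continuous.comp continuous_subtype_val)
  · exact isOpen_lt continuous_const
      (continuous_const.sub (contDiff_wsq.continuous.comp continuous_subtype_val))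

/-- **Indefinite fold charts at the points of the critical circle.**  At every point `P` of
`Z = {x₀ = 0, w = 0}` the map `f` has, in the smooth charts `Φ` (source, centred at `P`) and `Ψ`
(target), the normal form `(t, x₁, x₂, x₃) ↦ (t, x₁² + x₂² - x₃²)` of Hayano 2011, Def. 2.1 (4):
both charts are obtained from the explicit fold coordinates by the inverse function theorem, and
the normal form is the algebraic identity `psiE_mapE_one_eq`. [cite: Hayano2011, Def. 2.1 (4)] -/
theorem exists_foldChart (hρ0 : 0 < ρ) (hρ1 : ρ < 1) (P : 𝕊⁴) (h0 : (P : E5) 0 = 0)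
    (h3 : (P : E5) 3 = 0) (h4 : (P : E5) 4 = 0) :
    ∃ (φ : OpenPartialHomeomorph 𝕊⁴ E4) (ψ : OpenPartialHomeomorph 𝕊² E2),
      P ∈ φ.source ∧ φ P = 0 ∧ Set.MapsTo (adkMap hρ1.ne) φ.source ψ.source ∧
      ContMDiffOn (𝓡 4) (𝓡 4) ∞ φ φ.source ∧ ContMDiffOn (𝓡 4) (𝓡 4) ∞ φ.symm φ.target ∧
      ContMDiffOn (𝓡 2) (𝓡 2) ∞ ψ ψ.source ∧ ContMDiffOn (𝓡 2) (𝓡 2) ∞ ψ.symm ψ.target ∧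
      ∀ q ∈ φ.source, (ψ (adkMap hρ1.ne q)) 0 = (φ q) 0 ∧
        (ψ (adkMap hρ1.ne q)) 1 = (φ q) 1 ^ 2 + (φ q) 2 ^ 2 - (φ q) 3 ^ 2 := by
  set f := adkMap hρ1.ne with hf
  have hs := sum_sq_eq_one P
  set c₁ : ℝ := (P : E5) 1
  set c₂ : ℝ := (P : E5) 2
  have hz1 : zsq (P : E5) = 1 := zsq_of_memZ hs h0 h3 h4
  have hNP : nrm ρ (P : E5) ≠ 0 := (nrm_pos hρ1.ne P).ne'
  have hfP : ((f P : 𝕊²) : E3) = mapE ρ (P : E5) := rfl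
  -- the target chart
  set Ψ : 𝕊² → E2 := psiE ρ c₁ c₂ ∘ Subtype.val with hΨ
  set U2 : Set 𝕊² := {y | 1 + (y : E3) 2 ≠ 0} with hU2
  have hU2o : IsOpen U2 :=
    isOpen_ne_fun ((continuous_const.add ((EuclideanSpace.proj (2 : Fin 3)).continuous.comp
      continuous_subtype_val))) continuous_const
  have hy : 1 + mapE ρ (P : E5) 2 ≠ 0 := by
    rw [mapE_of_memZ_two hs h0 h3 h4,
      show (1 : ℝ) + (1 - ρ ^ 2) / (1 + ρ ^ 2) = 2 / (1 + ρ ^ 2) by field_simp; ring]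
    positivity
  have hPU2 : f P ∈ U2 := hy
  have hΨs : ContMDiffOn (𝓡 2) (𝓡 2) ∞ Ψ U2 := fun y hy' =>
    ((contDiffAt_psiE (ρ := ρ) c₁ c₂ hy').contMDiffAt.comp y
      (contMDiff_coe_sphere (n := 2) y)).contMDiffWithinAt
  have hΨinj : Injective (mfderiv (𝓡 2) (𝓡 2) Ψ (f P)) := by
    refine injective_mfderiv_comp_coe_sphere (n := 2)
      (((contDiffAt_psiE (ρ := ρ) c₁ c₂ hy).differentiableAt (by simp)).hasFDerivAt) ?_
    intro v hv hB
    exact eq_zero_of_fderiv_psiE_eq_zero hρ0 hs h0 h3 h4 hv hB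
  obtain ⟨eψ, hPψ, heqψ⟩ := isLocalDiffeomorphAt_sphere_of_injective hU2o hPU2 hΨs hΨinj
  -- the source chart
  set Φ : 𝕊⁴ → E4 := phiE ρ c₁ c₂ ∘ Subtype.val with hΦ
  have hPU4 : P ∈ foldDom ρ := by
    refine ⟨by rw [hz1]; exact one_pos, ?_⟩
    show 0 < 2 * ρ - ρ ^ 2 - wsq (P : E5)
    rw [wsq_of_memZ h3 h4]; nlinarith
  have hΦs : ContMDiffOn (𝓡 4) (𝓡 4) ∞ Φ (foldDom ρ) := fun q hq =>
    ((contDiffAt_phiE (ρ := ρ) c₁ c₂ (nrm_pos hρ1.ne q).ne' hq.1 hq.2).contMDiffAt.comp q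
      (contMDiff_coe_sphere (n := 4) q)).contMDiffWithinAt
  have hΦinj : Injective (mfderiv (𝓡 4) (𝓡 4) Φ P) := by
    refine injective_mfderiv_comp_coe_sphere (n := 4)
      (((contDiffAt_phiE (ρ := ρ) c₁ c₂ hNP hPU4.1 hPU4.2).differentiableAt (by simp)).hasFDerivAt)
      ?_
    intro v hv hB
    exact eq_zero_of_fderiv_phiE_eq_zero hρ0 hρ1 hs h0 h3 h4 hv hB
  obtain ⟨eφ, hPφ, heqφ⟩ := isLocalDiffeomorphAt_sphere_of_injective isOpen_foldDom hPU4 hΦs hΦinj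
  -- restrict the source chart
  set W : Set 𝕊⁴ := foldDom ρ ∩ f ⁻¹' eψ.source with hW
  have hWo : IsOpen W := isOpen_foldDom.inter (eψ.open_source.preimage (continuous_adkMap hρ1.ne))
  set φ := eφ.toOpenPartialHomeomorph.restrOpen W hWo with hφ
  set ψ := eψ.toOpenPartialHomeomorph with hψ
  have hφsrc : φ.source = eφ.source ∩ W := rfl
  have hφP : φ P = phiE ρ c₁ c₂ (P : E5) := (heqφ hPφ).symm
  refine ⟨φ, ψ, ⟨hPφ, hPU4, hPψ⟩, ?_, ?_, ?_, ?_, eψ.contMDiffOn_toFun, eψ.contMDiffOn_invFun, ?_⟩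
  · -- `φ P = 0`
    rw [hφP]
    ext i
    fin_cases i
    · simp only [Fin.zero_eta, phiE_apply_zero, PiLp.zero_apply]
      rw [mapE_of_memZ_zero hs h0 h3 h4, mapE_of_memZ_one hs h0 h3 h4]
      ring
    · simp [h3]
    · simp [h4]
    · simp [h0]
  · intro q hq
    exact hq.2.2
  · exact eφ.contMDiffOn_toFun.mono inter_subset_left
  · exact eφ.contMDiffOn_invFun.mono inter_subset_left
  · intro q hq
    obtain ⟨hqe, hqU, hqψ⟩ := hq
    have h1 : ψ (f q) = psiE ρ c₁ c₂ (mapE ρ (q : E5)) := (heqψ hqψ).symm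
    have h2 : φ q = phiE ρ c₁ c₂ (q : E5) := (heqφ hqe).symm
    rw [h1, h2]
    exact ⟨by simp, psiE_mapE_one_eq hρ1.ne c₁ c₂ q hqU.1 hqU.2⟩

/-- **The points of the critical circle are critical**: at `P ∈ Z` the differential of `f` is
not onto (read off the fold chart, whose centre is on the axis `x₁ = x₂ = x₃ = 0`).
[cite: Hayano2011, Def. 2.1 (4)] -/
theorem not_surjective_mfderiv_of_memZ (hρ0 : 0 < ρ) (hρ1 : ρ < 1) (P : 𝕊⁴) (h0 : (P : E5) 0 = 0)
    (h3 : (P : E5) 3 = 0) (h4 : (P : E5) 4 = 0) :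
    ¬ Surjective (mfderiv (𝓡 4) (𝓡 2) (adkMap hρ1.ne) P) := by
  obtain ⟨φ, ψ, hP, hP0, hmaps, hφ, hφs, hψ, hψs, hmodel⟩ := exists_foldChart hρ0 hρ1 P h0 h3 h4
  have h1 : (1 : ℕ∞ω) ≤ ∞ := by exact_mod_cast le_top
  rw [surjective_mfderiv_iff_of_fold_chart hmaps (hφ.of_le h1) (hφs.of_le h1) (hψ.of_le h1)
    (hψs.of_le h1) hmodel hP ((contMDiff_adkMap hρ1.ne P).mdifferentiableAt (by simp))]
  rw [hP0]
  simp

/-- **The critical set of `f` is exactly the circle `Z = {x₀ = x₃ = x₄ = 0}`.** [folklore] -/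
theorem not_surjective_mfderiv_iff (hρ0 : 0 < ρ) (hρ1 : ρ < 1) (p : 𝕊⁴) :
    ¬ Surjective (mfderiv (𝓡 4) (𝓡 2) (adkMap hρ1.ne) p) ↔
      (p : E5) 0 = 0 ∧ (p : E5) 3 = 0 ∧ (p : E5) 4 = 0 := by
  constructor
  · intro h
    by_contra hp
    exact h (surjective_mfderiv_adkMap hρ0 hρ1 p hp)
  · rintro ⟨h0, h3, h4⟩
    exact not_surjective_mfderiv_of_memZ hρ0 hρ1 p h0 h3 h4


/-! ### `f` is onto; `f` on the critical circle -/

/-- A point of `ℝ⁵` written out in coordinates lies on `S⁴` iff its squared coordinates sum to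
`1`. [folklore] -/
theorem mem_sphere_five_iff (x : E5) :
    x ∈ 𝕊⁴ ↔ x 0 ^ 2 + x 1 ^ 2 + x 2 ^ 2 + x 3 ^ 2 + x 4 ^ 2 = 1 := by
  rw [mem_sphere_zero_iff_norm, ← sq_eq_sq₀ (norm_nonneg _) zero_le_one, one_pow,
    EuclideanSpace.real_norm_sq_eq, Fin.sum_univ_five]

/-- **`f` is onto.**  The north pole is the image of the torus `u = 0`; a point `y` with `y₂ < 1`
corresponds to `c = (y₀, y₁)/(1 - y₂)` under stereographic projection and is the image of
`(0, c u, √s, 0)` with `u = s - ρ`, where `s ∈ (ρ, 1]` solves `|c|² (s - ρ)² + s = 1`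
(intermediate value theorem). [folklore] -/
theorem surjective_adkMap (hρ0 : 0 < ρ) (hρ1 : ρ < 1) : Surjective (adkMap hρ1.ne) := by
  intro y
  have hy := sum_sq_eq_one₂ y
  by_cases h2 : (y : E3) 2 = 1
  · -- the north pole
    have h0 : (y : E3) 0 = 0 := by nlinarith [sq_nonneg ((y : E3) 0), sq_nonneg ((y : E3) 1)]
    have h1 : (y : E3) 1 = 0 := by nlinarith [sq_nonneg ((y : E3) 0), sq_nonneg ((y : E3) 1)]
    set q : E5 := WithLp.toLp 2 ![0, Real.sqrt (1 - ρ), 0, Real.sqrt ρ, 0] with hq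
    have hqs : q ∈ 𝕊⁴ := by
      rw [mem_sphere_five_iff]
      simp [hq, Real.sq_sqrt hρ0.le, Real.sq_sqrt (sub_nonneg.2 hρ1.le)]
    refine ⟨⟨q, hqs⟩, Subtype.ext ?_⟩
    have hN : nrm ρ q = 1 - ρ := by
      simp [nrm, reU, hq, Real.sq_sqrt hρ0.le, Real.sq_sqrt (sub_nonneg.2 hρ1.le)]
    have hN0 : (1 : ℝ) - ρ ≠ 0 := by linarith
    change mapE ρ q = (y : E3)
    refine ext_three ?_ ?_ ?_
    · rw [mapE_apply, h0, hopfV_apply_zero]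
      simp [hq, reU, Real.sq_sqrt hρ0.le]
    · rw [mapE_apply, h1, hopfV_apply_one]
      simp [hq, reU, Real.sq_sqrt hρ0.le]
    · rw [mapE_apply, h2, hopfV_apply_two, hN]
      simp [hq, reU, Real.sq_sqrt hρ0.le, Real.sq_sqrt (sub_nonneg.2 hρ1.le), hN0]
  · -- the other points
    have hle : (y : E3) 2 ≤ 1 := by nlinarith [sq_nonneg ((y : E3) 0), sq_nonneg ((y : E3) 1)]
    have hlt : (y : E3) 2 < 1 := lt_of_le_of_ne hle h2
    set d : ℝ := 1 - (y : E3) 2 with hd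
    have hd0 : 0 < d := by rw [hd]; linarith
    set c₀ : ℝ := (y : E3) 0 / d
    set c₁ : ℝ := (y : E3) 1 / d
    set C : ℝ := c₀ ^ 2 + c₁ ^ 2 with hC
    -- the radius `s` of the `w`-circle, by the intermediate value theorem
    set g : ℝ → ℝ := fun s => C * (s - ρ) ^ 2 + s - 1 with hg
    have hgc : Continuous g := by rw [hg]; fun_prop
    have h0mem : (0 : ℝ) ∈ Set.Icc (g ρ) (g 1) := by
      constructor
      · simp only [hg]; nlinarith
      · simp only [hg]; nlinarith [sq_nonneg (1 - ρ), sq_nonneg c₀, sq_nonneg c₁]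
    obtain ⟨s, ⟨hsρ, hs1⟩, hgs⟩ := intermediate_value_Icc hρ1.le hgc.continuousOn h0mem
    simp only [hg] at hgs
    have hsρ' : ρ < s := by
      rcases hsρ.lt_or_eq with h | h
      · exact h
      · exfalso; rw [← h] at hgs; nlinarith
    set u : ℝ := s - ρ with hu
    have hu0 : 0 < u := by rw [hu]; linarith
    have hs0 : 0 ≤ s := by linarith
    set q : E5 := WithLp.toLp 2 ![0, c₀ * u, c₁ * u, Real.sqrt s, 0] with hq
    have hqs : q ∈ 𝕊⁴ := by
      rw [mem_sphere_five_iff]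
      simp only [hq]
      simp [Real.sq_sqrt hs0]
      rw [hC, hu] at *
      nlinarith [hgs]
    refine ⟨⟨q, hqs⟩, Subtype.ext ?_⟩
    have hre : reU ρ q = u := by simp [reU, hq, Real.sq_sqrt hs0, hu]
    have hN : nrm ρ q = (C + 1) * u ^ 2 := by
      rw [nrm_eq, hre]; simp [zsq, hq, hC]; ring
    have hCu : (C + 1) * u ^ 2 ≠ 0 := by positivity
    have hkey : (y : E3) 0 ^ 2 + (y : E3) 1 ^ 2 = d * (2 - d) := by rw [hd]; nlinarith
    change mapE ρ q = (y : E3)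
    refine ext_three ?_ ?_ ?_
    · rw [mapE_apply, hopfV_apply_zero, hre, hN]
      simp [hq]
      field_simp
      rw [hC]
      simp only [c₀, c₁]
      field_simp
      linear_combination (-(y : E3) 0) * hkey
    · rw [mapE_apply, hopfV_apply_one, hre, hN]
      simp [hq]
      field_simp
      rw [hC]
      simp only [c₀, c₁]
      field_simp
      linear_combination (-(y : E3) 1) * hkey
    · rw [mapE_apply, hopfV_apply_two, hre, hN]
      simp [hq]
      field_simp
      rw [hC]
      simp only [c₀, c₁]
      field_simp
      rw [hd] at hkey ⊢
      linear_combination (-(y : E3) 2) * hkey + hy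

/-- **`f` is injective on the critical circle**: `f(0, z, 0) = (-2ρ z, 1 - ρ²)/(1 + ρ²)`.
[folklore] -/
theorem injOn_adkMap_Z (hρ0 : 0 < ρ) (hρ1 : ρ < 1) :
    Set.InjOn (adkMap hρ1.ne) {p : 𝕊⁴ | (p : E5) 0 = 0 ∧ (p : E5) 3 = 0 ∧ (p : E5) 4 = 0} := by
  rintro p ⟨hp0, hp3, hp4⟩ q ⟨hq0, hq3, hq4⟩ h
  have hsp := sum_sq_eq_one p
  have hsq := sum_sq_eq_one q
  have h' : mapE ρ (p : E5) = mapE ρ (q : E5) := congrArg (fun y : 𝕊² => (y : E3)) h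
  have e0 := congrArg (fun y : E3 => y 0) h'
  have e1 := congrArg (fun y : E3 => y 1) h'
  simp only at e0 e1
  rw [mapE_of_memZ_zero hsp hp0 hp3 hp4, mapE_of_memZ_zero hsq hq0 hq3 hq4] at e0
  rw [mapE_of_memZ_one hsp hp0 hp3 hp4, mapE_of_memZ_one hsq hq0 hq3 hq4] at e1
  have h1 : (1 : ℝ) + ρ ^ 2 ≠ 0 := by positivity
  have hρ : (2 : ℝ) * ρ ≠ 0 := by positivity
  rw [div_left_inj' h1, neg_inj, mul_right_inj' hρ] at e0 e1
  exact Subtype.ext (ext_five (hp0.trans hq0.symm) e0 e1 (hp3.trans hq3.symm)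
    (hp4.trans hq4.symm))

/-- The critical circle parametrised by the angle. [folklore] -/
def zCircle (θ : ℝ) : E5 := WithLp.toLp 2 ![0, Real.cos θ, Real.sin θ, 0, 0]

/-- The parametrised critical circle lies on `S⁴`. [folklore] -/
theorem zCircle_mem (θ : ℝ) : zCircle θ ∈ 𝕊⁴ := by
  rw [mem_sphere_five_iff]
  simp [zCircle, Real.cos_sq_add_sin_sq]

/-- The parametrisation of the critical circle is continuous. [folklore] -/
theorem continuous_zCircle : Continuous zCircle := by
  have h : ContDiff ℝ ∞ zCircle := by
    rw [contDiff_euclidean]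
    intro i
    fin_cases i <;> simp [zCircle] <;> fun_prop
  exact h.continuous

/-- **The critical circle is connected** (a continuous image of `ℝ`). [folklore] -/
theorem isConnected_Z :
    IsConnected {p : 𝕊⁴ | (p : E5) 0 = 0 ∧ (p : E5) 3 = 0 ∧ (p : E5) 4 = 0} := by
  have hrange : Set.range (fun θ : ℝ => (⟨zCircle θ, zCircle_mem θ⟩ : 𝕊⁴)) =
      {p : 𝕊⁴ | (p : E5) 0 = 0 ∧ (p : E5) 3 = 0 ∧ (p : E5) 4 = 0} := by
    ext p
    simp only [Set.mem_range, Set.mem_setOf_eq]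
    constructor
    · rintro ⟨θ, rfl⟩
      simp [zCircle]
    · rintro ⟨h0, h3, h4⟩
      have hz : (p : E5) 1 ^ 2 + (p : E5) 2 ^ 2 = 1 := zsq_of_memZ (sum_sq_eq_one p) h0 h3 h4
      set ζ : ℂ := ⟨(p : E5) 1, (p : E5) 2⟩ with hζ
      have hζn : ‖ζ‖ = 1 := by
        rw [Complex.norm_def, Complex.normSq_mk, Real.sqrt_eq_one]; nlinarith
      refine ⟨Complex.arg ζ, Subtype.ext ?_⟩
      have hc : Real.cos (Complex.arg ζ) = (p : E5) 1 := by
        have := Complex.norm_mul_cos_arg ζ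
        rw [hζn, one_mul] at this
        exact this
      have hsn : Real.sin (Complex.arg ζ) = (p : E5) 2 := by
        have := Complex.norm_mul_sin_arg ζ
        rw [hζn, one_mul] at this
        exact this
      refine ext_five ?_ ?_ ?_ ?_ ?_
      · simp [zCircle, h0]
      · simp [zCircle, hc]
      · simp [zCircle, hsn]
      · simp [zCircle, h3]
      · simp [zCircle, h4]
  rw [← hrange]
  exact isConnected_range (continuous_zCircle.subtype_mk _)


/-! ### The fibres over the poles: the torus `u = 0` and the sphere `z = 0` -/

/-- A point of `ℝ³` written out in coordinates lies on `S²` iff its squared coordinates sum to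
`1`. [folklore] -/
theorem mem_sphere_three_iff (y : E3) : y ∈ 𝕊² ↔ y 0 ^ 2 + y 1 ^ 2 + y 2 ^ 2 = 1 := by
  rw [mem_sphere_zero_iff_norm, ← sq_eq_sq₀ (norm_nonneg _) zero_le_one, one_pow,
    EuclideanSpace.real_norm_sq_eq, Fin.sum_univ_three]

/-- The north pole `(0, 0, 1)` of `S²` (image of the torus `u = 0`). [folklore] -/
def northPole : 𝕊² := ⟨WithLp.toLp 2 ![0, 0, 1], by rw [mem_sphere_three_iff]; simp⟩

/-- The south pole `(0, 0, -1)` of `S²` (image of the sphere `z = 0`). [folklore] -/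
def southPole : 𝕊² := ⟨WithLp.toLp 2 ![0, 0, -1], by rw [mem_sphere_three_iff]; simp⟩

/-- The north pole has height `1`. [folklore] -/
@[simp] theorem northPole_apply_two : (northPole : E3) 2 = 1 := by simp [northPole]

/-- The south pole has height `-1`. [folklore] -/
@[simp] theorem southPole_apply_two : (southPole : E3) 2 = -1 := by simp [southPole]

/-- **The fibre over the north pole is the torus `{x₀ = 0, |w|² = ρ}`** (i.e. `u = 0`).
[folklore] -/
theorem adkMap_eq_northPole_iff (hρ : ρ ≠ 1) (q : 𝕊⁴) :
    adkMap hρ q = northPole ↔ (q : E5) 0 = 0 ∧ wsq (q : E5) = ρ := by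
  have hN : nrm ρ (q : E5) ≠ 0 := (nrm_pos hρ q).ne'
  have hNq := nrm_eq (ρ := ρ) (q : E5)
  constructor
  · intro h
    have h2 : mapE ρ (q : E5) 2 = 1 := by
      have := congrArg (fun y : 𝕊² => (y : E3) 2) h
      simpa using this
    rw [mapE_apply, hopfV_apply_two, inv_mul_eq_div, div_eq_one_iff_eq hN, hNq] at h2
    unfold zsq at h2
    have ha : reU ρ (q : E5) = 0 := by nlinarith [sq_nonneg (reU ρ (q : E5)), sq_nonneg ((q : E5) 0)]
    have h0 : (q : E5) 0 = 0 := by nlinarith [sq_nonneg (reU ρ (q : E5)), sq_nonneg ((q : E5) 0)]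
    exact ⟨h0, by rw [reU_eq] at ha; linarith⟩
  · rintro ⟨h0, hw⟩
    have ha : reU ρ (q : E5) = 0 := by rw [reU_eq, hw]; ring
    have hNz : nrm ρ (q : E5) = zsq (q : E5) := by rw [hNq, ha, h0]; ring
    apply Subtype.ext
    change mapE ρ (q : E5) = (northPole : E3)
    refine ext_three ?_ ?_ ?_
    · rw [mapE_apply, hopfV_apply_zero, ha, h0]; simp [northPole]
    · rw [mapE_apply, hopfV_apply_one, ha, h0]; simp [northPole]
    · rw [mapE_apply, hopfV_apply_two, ha, h0, hNz]
      rw [hNz] at hN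
      unfold zsq at hN ⊢
      simp only [northPole]
      field_simp
      simp

/-- **The fibre over the south pole is the 2-sphere `{z = 0}`.** [folklore] -/
theorem adkMap_eq_southPole_iff (hρ : ρ ≠ 1) (q : 𝕊⁴) :
    adkMap hρ q = southPole ↔ (q : E5) 1 = 0 ∧ (q : E5) 2 = 0 := by
  have hN : nrm ρ (q : E5) ≠ 0 := (nrm_pos hρ q).ne'
  have hNq := nrm_eq (ρ := ρ) (q : E5)
  constructor
  · intro h
    have h2 : mapE ρ (q : E5) 2 = -1 := by
      have := congrArg (fun y : 𝕊² => (y : E3) 2) h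
      simpa using this
    rw [mapE_apply, hopfV_apply_two, inv_mul_eq_div, div_eq_iff hN, hNq] at h2
    unfold zsq at h2
    constructor
    · nlinarith [sq_nonneg ((q : E5) 1), sq_nonneg ((q : E5) 2)]
    · nlinarith [sq_nonneg ((q : E5) 1), sq_nonneg ((q : E5) 2)]
  · rintro ⟨h1, h2⟩
    have hNz : nrm ρ (q : E5) = reU ρ (q : E5) ^ 2 + (q : E5) 0 ^ 2 := by
      rw [hNq]; unfold zsq; rw [h1, h2]; ring
    apply Subtype.ext
    change mapE ρ (q : E5) = (southPole : E3)
    refine ext_three ?_ ?_ ?_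
    · rw [mapE_apply, hopfV_apply_zero, h1, h2]; simp [southPole]
    · rw [mapE_apply, hopfV_apply_one, h1, h2]; simp [southPole]
    · rw [mapE_apply, hopfV_apply_two, h1, h2, hNz]
      rw [hNz] at hN
      simp only [southPole]
      field_simp
      simp
      ring

/-! #### The torus -/

/-- The standard parametrisation of the torus fibre by `S¹ × S¹ ⊆ ℂ × ℂ`:
`(a, b) ↦ (0, √(1-ρ) a, √ρ b)`. [folklore] -/
def torusPt (ρ : ℝ) (a b : Circle) : E5 :=
  WithLp.toLp 2 ![0, Real.sqrt (1 - ρ) * (a : ℂ).re, Real.sqrt (1 - ρ) * (a : ℂ).im,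
    Real.sqrt ρ * (b : ℂ).re, Real.sqrt ρ * (b : ℂ).im]

/-- The torus parametrisation lands on `S⁴`. [folklore] -/
theorem torusPt_mem (hρ0 : 0 ≤ ρ) (hρ1 : ρ ≤ 1) (a b : Circle) : torusPt ρ a b ∈ 𝕊⁴ := by
  rw [mem_sphere_five_iff]
  simp only [torusPt]
  simp
  have ha := BraidFraming.re_sq_add_im_sq a
  have hb := BraidFraming.re_sq_add_im_sq b
  have h1 := Real.sq_sqrt hρ0
  have h2 := Real.sq_sqrt (sub_nonneg.2 hρ1)
  nlinarith

/-- The torus parametrisation has `|w|² = ρ`. [folklore] -/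
theorem wsq_torusPt (hρ0 : 0 ≤ ρ) (a b : Circle) : wsq (torusPt ρ a b) = ρ := by
  simp only [wsq, torusPt]
  simp
  have hb := BraidFraming.re_sq_add_im_sq b
  have h1 := Real.sq_sqrt hρ0
  nlinarith

/-- The torus parametrisation is continuous. [folklore] -/
theorem continuous_torusPt : Continuous fun ab : Circle × Circle => torusPt ρ ab.1 ab.2 := by
  unfold torusPt
  refine (PiLp.continuous_toLp 2 (fun _ : Fin 5 => ℝ)).comp (continuous_pi fun i => ?_)
  fin_cases i <;> simp <;> fun_prop



section Torus

variable (hρ0 : 0 < ρ) (hρ1 : ρ < 1)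
include hρ0 hρ1

/-- The torus parametrisation, valued in the fibre of `f` over the north pole. [folklore] -/
def torusMap (ab : Circle × Circle) : ↥((adkMap hρ1.ne) ⁻¹' {northPole}) :=
  ⟨⟨torusPt ρ ab.1 ab.2, torusPt_mem hρ0.le hρ1.le ab.1 ab.2⟩, by
    rw [Set.mem_preimage, Set.mem_singleton_iff, adkMap_eq_northPole_iff]
    exact ⟨by simp [torusPt], wsq_torusPt hρ0.le ab.1 ab.2⟩⟩

/-- The torus parametrisation of the fibre is continuous. [folklore] -/
theorem continuous_torusMap : Continuous (torusMap hρ0 hρ1) :=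
  (continuous_torusPt.subtype_mk _).subtype_mk _

/-- The torus parametrisation of the fibre is injective. [folklore] -/
theorem torusMap_injective : Injective (torusMap hρ0 hρ1) := by
  rintro ⟨a, b⟩ ⟨a', b'⟩ h
  have h' : torusPt ρ a b = torusPt ρ a' b' :=
    congrArg (fun q : ↥((adkMap hρ1.ne) ⁻¹' {northPole}) => ((q : 𝕊⁴) : E5)) h
  have h1 := congrArg (fun x : E5 => x 1) h'
  have h2 := congrArg (fun x : E5 => x 2) h'
  have h3 := congrArg (fun x : E5 => x 3) h'
  have h4 := congrArg (fun x : E5 => x 4) h'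
  simp only [torusPt] at h1 h2 h3 h4
  simp at h1 h2 h3 h4
  have hs1 : Real.sqrt (1 - ρ) ≠ 0 := (Real.sqrt_pos.2 (by linarith)).ne'
  have hs2 : Real.sqrt ρ ≠ 0 := (Real.sqrt_pos.2 hρ0).ne'
  simp only [hs1, hs2, or_false] at h1 h2 h3 h4
  refine Prod.ext (Circle.ext (Complex.ext h1 h2)) (Circle.ext (Complex.ext h3 h4))

/-- The torus parametrisation of the fibre is onto: a point with `x₀ = 0`, `|w|² = ρ` has `z/√(1-ρ)` and `w/√ρ` on the unit circle. [folklore] -/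
theorem torusMap_surjective : Surjective (torusMap hρ0 hρ1) := by
  rintro ⟨q, hq⟩
  rw [Set.mem_preimage, Set.mem_singleton_iff, adkMap_eq_northPole_iff] at hq
  obtain ⟨h0, hw⟩ := hq
  have hs := sum_sq_eq_one q
  have hz : (q : E5) 1 ^ 2 + (q : E5) 2 ^ 2 = 1 - ρ := by unfold wsq at hw; nlinarith
  have hs1 : 0 < Real.sqrt (1 - ρ) := Real.sqrt_pos.2 (by linarith)
  have hs2 : 0 < Real.sqrt ρ := Real.sqrt_pos.2 hρ0
  have hq1 := Real.sq_sqrt (sub_nonneg.2 hρ1.le)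
  have hq2 := Real.sq_sqrt hρ0.le
  set a : ℂ := ⟨(q : E5) 1 / Real.sqrt (1 - ρ), (q : E5) 2 / Real.sqrt (1 - ρ)⟩ with ha
  set b : ℂ := ⟨(q : E5) 3 / Real.sqrt ρ, (q : E5) 4 / Real.sqrt ρ⟩ with hb
  have han : ‖a‖ = 1 := by
    rw [Complex.norm_def, Complex.normSq_mk, Real.sqrt_eq_one]
    field_simp
    rw [hq1]; linarith
  have hbn : ‖b‖ = 1 := by
    rw [Complex.norm_def, Complex.normSq_mk, Real.sqrt_eq_one]
    field_simp
    rw [hq2]; unfold wsq at hw; linarith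
  refine ⟨(⟨a, mem_sphere_zero_iff_norm.2 han⟩, ⟨b, mem_sphere_zero_iff_norm.2 hbn⟩), ?_⟩
  apply Subtype.ext
  apply Subtype.ext
  change torusPt ρ _ _ = (q : E5)
  refine ext_five ?_ ?_ ?_ ?_ ?_
  · simp [torusPt, h0]
  · simp [torusPt, ha]; field_simp
  · simp [torusPt, ha]; field_simp
  · simp [torusPt, hb]; field_simp
  · simp [torusPt, hb]; field_simp

/-- **The fibre over the north pole is homeomorphic to the torus `S¹ × S¹`.** [folklore] -/
def northFibreHomeomorph : ↥((adkMap hρ1.ne) ⁻¹' {northPole}) ≃ₜ Circle × Circle :=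
  (Continuous.homeoOfEquivCompactToT2
    (f := Equiv.ofBijective _ ⟨torusMap_injective hρ0 hρ1, torusMap_surjective hρ0 hρ1⟩)
    (continuous_torusMap hρ0 hρ1)).symm

/-- `S¹ × S¹ ≃ₜ T²` for the tree's torus `Torus 2 = (ℝ/ℤ)²`. [folklore] -/
def circleProdHomeomorphTorus :
    Circle × Circle ≃ₜ Literature.AlgebraicTopology.SingularHomology.Torus 2 :=
  ((AddCircle.homeomorphCircle one_ne_zero).symm.prodCongr
    (AddCircle.homeomorphCircle one_ne_zero).symm).trans
    (((Homeomorph.funUnique (Fin 1) UnitAddCircle).symm.prodCongr (Homeomorph.refl _)).trans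
      (Literature.AlgebraicTopology.SingularHomology.torusSplit 1).symm)

omit hρ0 hρ1 in
/-- `S¹ ⊆ ℂ` is connected. [folklore] -/
theorem connectedSpace_circle : ConnectedSpace Circle :=
  (AddCircle.homeomorphCircle (one_ne_zero (α := ℝ))).surjective.connectedSpace
    (AddCircle.homeomorphCircle _).continuous

/-- **The fibre over the north pole is connected with `H₁ ≅ ℤ²`** (a torus; Hatcher 2002, §3.3
p. 231 for `H₁(T²)`, the tree's `nonempty_singularHomology_torus_equiv`).
[cite: HatcherAT2002, §3.3 p. 231] -/
theorem northFibre_isConnected_and_homology :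
    IsConnected ((adkMap hρ1.ne) ⁻¹' {northPole}) ∧
      Nonempty ((Fin 2 → ℤ) ≃ₗ[ℤ] Literature.AlgebraicTopology.SingularHomology.singularHomology ℤ ℤ
        ↥((adkMap hρ1.ne) ⁻¹' {northPole}) 1) := by
  haveI := connectedSpace_circle
  set e := (northFibreHomeomorph hρ0 hρ1).trans circleProdHomeomorphTorus with he
  constructor
  · rw [isConnected_iff_connectedSpace]
    exact e.symm.surjective.connectedSpace e.symm.continuous
  · obtain ⟨l⟩ := Literature.AlgebraicTopology.SingularHomology.nonempty_singularHomology_torus_equiv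
      ℤ ℤ 2 1
    exact ⟨(LinearEquiv.funCongrLeft ℤ ℤ (finCongr (by decide : Nat.choose 2 1 = 2))).trans
      (l.symm.trans (Literature.AlgebraicTopology.SingularHomology.singularHomology.mapIso ℤ ℤ e 1).toLinearEquiv.symm)⟩

end Torus

/-! #### The sphere -/

section SphereFibre

variable (hρ1 : ρ ≠ 1)
include hρ1

/-- The standard parametrisation of the sphere fibre: `y ↦ (y₀, 0, 0, y₁, y₂)`. [folklore] -/
def spherePt (y : E3) : E5 := WithLp.toLp 2 ![y 0, 0, 0, y 1, y 2]

omit hρ1 in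
/-- The sphere parametrisation lands on `S⁴`. [folklore] -/
theorem spherePt_mem (y : 𝕊²) : spherePt (y : E3) ∈ 𝕊⁴ := by
  rw [mem_sphere_five_iff]
  have := sum_sq_eq_one₂ y
  simp [spherePt]
  linarith

omit hρ1 in
/-- The sphere parametrisation is continuous. [folklore] -/
theorem continuous_spherePt : Continuous spherePt := by
  unfold spherePt
  refine (PiLp.continuous_toLp 2 (fun _ : Fin 5 => ℝ)).comp (continuous_pi fun i => ?_)
  fin_cases i <;> simp <;> fun_prop

/-- The sphere parametrisation, valued in the fibre of `f` over the south pole. [folklore] -/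
def sphereMap (y : 𝕊²) : ↥((adkMap hρ1) ⁻¹' {southPole}) :=
  ⟨⟨spherePt (y : E3), spherePt_mem y⟩, by
    rw [Set.mem_preimage, Set.mem_singleton_iff, adkMap_eq_southPole_iff]
    simp [spherePt]⟩

/-- The sphere parametrisation of the fibre is continuous. [folklore] -/
theorem continuous_sphereMap : Continuous (sphereMap hρ1) :=
  ((continuous_spherePt.comp continuous_subtype_val).subtype_mk _).subtype_mk _

/-- The sphere parametrisation of the fibre is injective. [folklore] -/
theorem sphereMap_injective : Injective (sphereMap hρ1) := by
  intro y y' h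
  have h' : spherePt (y : E3) = spherePt (y' : E3) :=
    congrArg (fun q : ↥((adkMap hρ1) ⁻¹' {southPole}) => ((q : 𝕊⁴) : E5)) h
  have h0 := congrArg (fun x : E5 => x 0) h'
  have h3 := congrArg (fun x : E5 => x 3) h'
  have h4 := congrArg (fun x : E5 => x 4) h'
  simp [spherePt] at h0 h3 h4
  exact Subtype.ext (ext_three h0 h3 h4)

/-- The sphere parametrisation of the fibre is onto. [folklore] -/
theorem sphereMap_surjective : Surjective (sphereMap hρ1) := by
  rintro ⟨q, hq⟩
  rw [Set.mem_preimage, Set.mem_singleton_iff, adkMap_eq_southPole_iff] at hq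
  obtain ⟨h1, h2⟩ := hq
  have hs := sum_sq_eq_one q
  set y : E3 := WithLp.toLp 2 ![(q : E5) 0, (q : E5) 3, (q : E5) 4] with hy
  have hym : y ∈ 𝕊² := by
    rw [mem_sphere_three_iff]; simp [hy]; nlinarith
  refine ⟨⟨y, hym⟩, ?_⟩
  apply Subtype.ext
  apply Subtype.ext
  change spherePt y = (q : E5)
  refine ext_five ?_ ?_ ?_ ?_ ?_ <;> simp [spherePt, hy, h1, h2]

/-- **The fibre over the south pole is homeomorphic to `S²`.** [folklore] -/
def southFibreHomeomorph : ↥((adkMap hρ1) ⁻¹' {southPole}) ≃ₜ 𝕊² :=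
  (Continuous.homeoOfEquivCompactToT2
    (f := Equiv.ofBijective _ ⟨sphereMap_injective hρ1, sphereMap_surjective hρ1⟩)
    (continuous_sphereMap hρ1)).symm

/-- **The fibre over the south pole is connected with `H₁ = 0`** (a 2-sphere; Hatcher 2002,
Cor. 2.14, the tree's `isZero_singularHomology_unitSphere`). [cite: HatcherAT2002, Cor. 2.14] -/
theorem southFibre_isConnected_and_homology :
    IsConnected ((adkMap hρ1) ⁻¹' {southPole}) ∧
      Nonempty ((Fin 0 → ℤ) ≃ₗ[ℤ] Literature.AlgebraicTopology.SingularHomology.singularHomology ℤ ℤ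
        ↥((adkMap hρ1) ⁻¹' {southPole}) 1) := by
  set e := southFibreHomeomorph hρ1 with he
  constructor
  · rw [isConnected_iff_connectedSpace]
    haveI : ConnectedSpace 𝕊² := by
      refine isConnected_iff_connectedSpace.1 (isConnected_sphere ?_ (0 : E3) zero_le_one)
      rw [← Module.finrank_eq_rank, finrank_euclideanSpace_fin]
      norm_num
    exact e.symm.surjective.connectedSpace e.symm.continuous
  · have hz := Literature.AlgebraicTopology.SingularHomology.isZero_singularHomology_unitSphere
      ℤ ℤ 2 1 one_ne_zero (by norm_num)
    haveI := ModuleCat.subsingleton_of_isZero (hz.of_iso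
      (Literature.AlgebraicTopology.SingularHomology.singularHomology.mapIso ℤ ℤ e 1))
    exact ⟨LinearEquiv.ofSubsingleton _ _⟩

end SphereFibre


/-! ### Caps of a sphere are connected -/

/-- **Open caps of a round sphere are preconnected**: for a unit vector `v` and `c < 1`, the cap
`{y ∈ S | ⟪y, v⟫ < c}` is the image of a ball under the inverse stereographic projection from
`v` (Mathlib's `stereographic`), hence preconnected. [folklore] -/
theorem isPreconnected_sphere_inner_lt {E : Type*} [NormedAddCommGroup E] [InnerProductSpace ℝ E]
    {v : E} (hv : ‖v‖ = 1) {c : ℝ} (hc : c < 1) :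
    IsPreconnected {y : sphere (0 : E) 1 | inner ℝ (y : E) v < c} := by
  set K : ℝ := 4 * (1 + c) / (1 - c) with hK
  set B : Set (ℝ ∙ v)ᗮ := Metric.ball 0 (Real.sqrt K) with hB
  -- the height of the inverse stereographic projection
  have key : ∀ w : (ℝ ∙ v)ᗮ,
      inner ℝ (((stereographic hv).symm w : sphere (0 : E) 1) : E) v =
        (‖w‖ ^ 2 + 4)⁻¹ * (‖w‖ ^ 2 - 4) := by
    intro w
    have hw : inner ℝ (w : E) v = 0 := Submodule.mem_orthogonal_singleton_iff_inner_left.1 w.2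
    have hvv : inner ℝ v v = 1 := by rw [real_inner_self_eq_norm_sq, hv, one_pow]
    change inner ℝ ((stereoInvFun hv w : sphere (0 : E) 1) : E) v = _
    rw [stereoInvFun_apply, real_inner_smul_left, inner_add_left, real_inner_smul_left,
      real_inner_smul_left, hw, hvv]
    ring
  have hmem : ∀ w : (ℝ ∙ v)ᗮ, w ∈ B ↔ (‖w‖ ^ 2 + 4)⁻¹ * (‖w‖ ^ 2 - 4) < c := by
    intro w
    rw [hB, Metric.mem_ball, dist_zero_right, Real.lt_sqrt (norm_nonneg _)]
    have hpos : 0 < ‖w‖ ^ 2 + 4 := by positivity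
    rw [inv_mul_lt_iff₀ hpos, hK, lt_div_iff₀ (by linarith)]
    constructor <;> intro h <;> nlinarith
  have hset : {y : sphere (0 : E) 1 | inner ℝ (y : E) v < c} = (stereographic hv).symm '' B := by
    ext y
    simp only [Set.mem_setOf_eq, Set.mem_image]
    constructor
    · intro hy
      have hne : (y : E) ≠ v := by
        intro h
        rw [h, real_inner_self_eq_norm_sq, hv, one_pow] at hy
        linarith
      have hsrc : y ∈ (stereographic hv).source := by
        rw [stereographic_source]
        exact fun h => hne (congrArg Subtype.val h)
      refine ⟨stereographic hv y, ?_, (stereographic hv).left_inv hsrc⟩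
      rw [hmem, ← key, (stereographic hv).left_inv hsrc]
      exact hy
    · rintro ⟨w, hw, rfl⟩
      rw [key, ← hmem]
      exact hw
  rw [hset]
  exact ((convex_ball _ _).isPreconnected).image _
    ((stereographic hv).continuousOn_symm.mono (by rw [stereographic_target]; exact subset_univ _))

/-- The height of the critical circle, `h_c = (1 - ρ²)/(1 + ρ²)`. [folklore] -/
def hcrit (ρ : ℝ) : ℝ := (1 - ρ ^ 2) / (1 + ρ ^ 2)

/-- `h_c < 1` (the north pole is a regular value). [folklore] -/
theorem hcrit_lt_one (hρ0 : 0 < ρ) : hcrit ρ < 1 := by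
  unfold hcrit
  rw [div_lt_one (by positivity)]
  nlinarith

/-- `-1 < h_c` (the south pole is a regular value). [folklore] -/
theorem neg_one_lt_hcrit : -1 < hcrit ρ := by
  unfold hcrit
  rw [lt_div_iff₀ (by positivity)]
  nlinarith [sq_nonneg ρ]

/-- The upper cap `{y₂ > h_c}` (regular values on the torus side). [folklore] -/
def capN (ρ : ℝ) : Set 𝕊² := {y | hcrit ρ < (y : E3) 2}

/-- The lower cap `{y₂ < h_c}` (regular values on the sphere side). [folklore] -/
def capS (ρ : ℝ) : Set 𝕊² := {y | (y : E3) 2 < hcrit ρ}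

/-- The upper cap is open. [folklore] -/
theorem isOpen_capN : IsOpen (capN ρ) :=
  isOpen_lt continuous_const ((EuclideanSpace.proj (2 : Fin 3)).continuous.comp
    continuous_subtype_val)

/-- The lower cap is open. [folklore] -/
theorem isOpen_capS : IsOpen (capS ρ) :=
  isOpen_lt ((EuclideanSpace.proj (2 : Fin 3)).continuous.comp continuous_subtype_val)
    continuous_const

/-- The north pole lies in the upper cap. [folklore] -/
theorem northPole_mem_capN (hρ0 : 0 < ρ) : northPole ∈ capN ρ := by
  show hcrit ρ < (northPole : E3) 2
  rw [northPole_apply_two]; exact hcrit_lt_one hρ0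

/-- The south pole lies in the lower cap. [folklore] -/
theorem southPole_mem_capS : southPole ∈ capS ρ := by
  show (southPole : E3) 2 < hcrit ρ
  rw [southPole_apply_two]; exact neg_one_lt_hcrit

/-- The upper cap is preconnected (a cap about the north pole, read as `⟪y, S⟫ < -h_c`). [folklore] -/
theorem isPreconnected_capN : IsPreconnected (capN ρ) := by
  have h := isPreconnected_sphere_inner_lt (E := E3) (v := (southPole : E3)) (by simp)
    (c := -hcrit ρ) (by linarith [neg_one_lt_hcrit (ρ := ρ)])
  convert h using 1
  ext y
  simp [capN, inner_three, southPole]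

/-- The lower cap is preconnected (a cap about the south pole, read as `⟪y, N⟫ < h_c`). [folklore] -/
theorem isPreconnected_capS (hρ0 : 0 < ρ) : IsPreconnected (capS ρ) := by
  have h := isPreconnected_sphere_inner_lt (E := E3) (v := (northPole : E3)) (by simp)
    (c := hcrit ρ) (hcrit_lt_one hρ0)
  convert h using 1
  ext y
  simp [capS, inner_three, northPole]

/-! ### Regular values and the transfer along the caps -/

/-- **A value of `f` all of whose preimages are regular is off the critical latitude**: every
point of the circle `y₂ = h_c` is `f(P)` for a point `P` of the critical circle. [folklore] -/
theorem apply_two_ne_hcrit_of_regular (hρ0 : 0 < ρ) (hρ1 : ρ < 1) {y : 𝕊²}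
    (hy : ∀ q, adkMap hρ1.ne q = y → Surjective (mfderiv (𝓡 4) (𝓡 2) (adkMap hρ1.ne) q)) :
    (y : E3) 2 ≠ hcrit ρ := by
  intro h2
  have hys := sum_sq_eq_one₂ y
  set k : ℝ := 2 * ρ / (1 + ρ ^ 2) with hk
  have hk0 : k ≠ 0 := by positivity
  have h1ρ : (1 : ℝ) + ρ ^ 2 ≠ 0 := by positivity
  have hk2 : (y : E3) 0 ^ 2 + (y : E3) 1 ^ 2 = k ^ 2 := by
    rw [h2, hcrit] at hys
    rw [hk]
    field_simp
    field_simp at hys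
    linear_combination hys
  set P : E5 := WithLp.toLp 2 ![0, -(y : E3) 0 / k, -(y : E3) 1 / k, 0, 0] with hP
  have hPs : P ∈ 𝕊⁴ := by
    rw [mem_sphere_five_iff]
    simp [hP]
    field_simp
    linear_combination hk2
  have hsP := sum_sq_eq_one ⟨P, hPs⟩
  have hP0 : P 0 = 0 := by simp [hP]
  have hP3 : P 3 = 0 := by simp [hP]
  have hP4 : P 4 = 0 := by simp [hP]
  have hfP : adkMap hρ1.ne ⟨P, hPs⟩ = y := by
    apply Subtype.ext
    change mapE ρ P = (y : E3)
    refine ext_three ?_ ?_ ?_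
    · rw [mapE_of_memZ_zero hsP hP0 hP3 hP4]
      simp [hP, hk]
      field_simp
    · rw [mapE_of_memZ_one hsP hP0 hP3 hP4]
      simp [hP, hk]
      field_simp
    · rw [mapE_of_memZ_two hsP hP0 hP3 hP4, h2, hcrit]
  exact not_surjective_mfderiv_of_memZ hρ0 hρ1 ⟨P, hPs⟩ hP0 hP3 hP4 (hy _ hfP)

/-- Points over the caps are regular. [folklore] -/
theorem surjective_mfderiv_of_apply_two_ne (hρ0 : 0 < ρ) (hρ1 : ρ < 1) (q : 𝕊⁴)
    (hq : ((adkMap hρ1.ne q : 𝕊²) : E3) 2 ≠ hcrit ρ) :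
    Surjective (mfderiv (𝓡 4) (𝓡 2) (adkMap hρ1.ne) q) := by
  by_contra h
  obtain ⟨h0, h3, h4⟩ := (not_surjective_mfderiv_iff hρ0 hρ1 q).1 h
  exact hq (by rw [coe_adkMap, mapE_of_memZ_two (sum_sq_eq_one q) h0 h3 h4, hcrit])

/-- **Ehresmann transfer**: over a preconnected open set of regular values all fibres of `f` are
homeomorphic (Bröcker–Jänich (8.12), the tree's PROVED Ehresmann theorem via
`isFibreBundleWith_restrictPreimage`). [cite: BrockerJanichIDT1982, (8.12)] -/
theorem nonempty_fibre_homeomorph (hρ : ρ ≠ 1) {W : Set 𝕊²} (hWo : IsOpen W)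
    (hWc : IsPreconnected W)
    (hW : ∀ y ∈ W, ∀ q, adkMap hρ q = y → Surjective (mfderiv (𝓡 4) (𝓡 2) (adkMap hρ) q))
    {y₀ y : 𝕊²} (hy₀ : y₀ ∈ W) (hy : y ∈ W) :
    Nonempty (↥((adkMap hρ) ⁻¹' {y}) ≃ₜ ↥((adkMap hρ) ⁻¹' {y₀})) := by
  set f := adkMap hρ with hf
  have h := isFibreBundleWith_restrictPreimage (contMDiff_adkMap hρ) hWo hWc hW hy₀
  obtain ⟨e⟩ := h.nonempty_fibre_homeomorph ⟨y, hy⟩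
  -- the fibre of the restriction over `y` is the fibre of `f` over `y`
  have hemb : Topology.IsEmbedding (fun z : ↥((W.restrictPreimage f) ⁻¹' {⟨y, hy⟩}) =>
      ((z : ↥(f ⁻¹' W)) : 𝕊⁴)) :=
    Topology.IsEmbedding.subtypeVal.comp Topology.IsEmbedding.subtypeVal
  have hrange : Set.range (fun z : ↥((W.restrictPreimage f) ⁻¹' {⟨y, hy⟩}) =>
      ((z : ↥(f ⁻¹' W)) : 𝕊⁴)) = f ⁻¹' {y} := by
    ext x
    simp only [Set.mem_range, Set.mem_preimage, Set.mem_singleton_iff]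
    constructor
    · rintro ⟨z, rfl⟩
      have hz := z.2
      rw [Set.mem_preimage, Set.mem_singleton_iff, Subtype.ext_iff] at hz
      exact hz
    · intro hx
      have hxW : x ∈ f ⁻¹' W := by rw [Set.mem_preimage, hx]; exact hy
      exact ⟨⟨⟨x, hxW⟩, by rw [Set.mem_preimage, Set.mem_singleton_iff, Subtype.ext_iff]; exact hx⟩,
        rfl⟩
  exact ⟨(hemb.toHomeomorph.trans (Homeomorph.setCongr hrange)).symm.trans e⟩

/-! ### Assembly -/

open Literature.AlgebraicTopology.SingularHomology in
/-- **The explicit map `f : S⁴ → S²` is a genus-one simplified broken Lefschetz fibration with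
empty Lefschetz set and non-empty connected round locus** (for every `0 < ρ < 1` and every
smooth orientation of `S⁴`): the clauses of `IsSimplifiedBrokenLefschetzFibration o f ∅ 0`,
namely smoothness and surjectivity of `f`, indefinite fold charts along the critical circle `Z`
(the whole critical set), connectedness of `Z`, injectivity of `f` on `Z`, and the regular
fibres: tori (`H₁ ≅ ℤ²`) over the cap `y₂ > h_c` and spheres (`H₁ = 0`) over `y₂ < h_c`, by
Ehresmann transfer from the two polar fibres.  This realises Auroux–Donaldson–Katzarkov 2005,
§8.2, Example 1 on `S⁴`. [cite: AurouxDonaldsonKatzarkov2005, §8.2 Example 1] -/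
theorem isSimplifiedBrokenLefschetzFibration_adkMap (hρ0 : 0 < ρ) (hρ1 : ρ < 1)
    (o : SmoothOrientation (𝓡 4) 𝕊⁴) :
    IsSimplifiedBrokenLefschetzFibration o (adkMap hρ1.ne) ∅ 0 where
  contMDiff := contMDiff_adkMap hρ1.ne
  surjective := surjective_adkMap hρ0 hρ1
  lefschetz := fun p hp => absurd hp (Finset.notMem_empty p)
  fold := fun p hp _ => by
    obtain ⟨h0, h3, h4⟩ := (not_surjective_mfderiv_iff hρ0 hρ1 p).1 hp
    exact exists_foldChart hρ0 hρ1 p h0 h3 h4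
  isConnected_round := by
    have hset : {p : 𝕊⁴ | ¬ Surjective (mfderiv (𝓡 4) (𝓡 2) (adkMap hρ1.ne) p)} \
        (↑(∅ : Finset 𝕊⁴) : Set 𝕊⁴) =
        {p : 𝕊⁴ | (p : E5) 0 = 0 ∧ (p : E5) 3 = 0 ∧ (p : E5) 4 = 0} := by
      rw [Finset.coe_empty, sdiff_empty]
      ext p
      exact not_surjective_mfderiv_iff hρ0 hρ1 p
    rw [hset]
    exact isConnected_Z
  injOn_crit := by
    have hset : {p : 𝕊⁴ | ¬ Surjective (mfderiv (𝓡 4) (𝓡 2) (adkMap hρ1.ne) p)} =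
        {p : 𝕊⁴ | (p : E5) 0 = 0 ∧ (p : E5) 3 = 0 ∧ (p : E5) 4 = 0} := by
      ext p
      exact not_surjective_mfderiv_iff hρ0 hρ1 p
    rw [hset]
    exact injOn_adkMap_Z hρ0 hρ1
  fibre := fun y hy => by
    have hne := apply_two_ne_hcrit_of_regular hρ0 hρ1 hy
    rcases lt_or_gt_of_ne hne with hlt | hgt
    · -- sphere side
      have hyS : y ∈ capS ρ := hlt
      have hW : ∀ y' ∈ capS ρ, ∀ q, adkMap hρ1.ne q = y' →
          Surjective (mfderiv (𝓡 4) (𝓡 2) (adkMap hρ1.ne) q) := fun y' hy' q hq =>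
        surjective_mfderiv_of_apply_two_ne hρ0 hρ1 q (by rw [hq]; exact hy'.ne)
      obtain ⟨e⟩ := nonempty_fibre_homeomorph hρ1.ne isOpen_capS (isPreconnected_capS hρ0) hW
        southPole_mem_capS hyS
      obtain ⟨hc, ⟨l⟩⟩ := southFibre_isConnected_and_homology hρ1.ne
      refine ⟨?_, Or.inr ⟨l.trans (singularHomology.mapIso ℤ ℤ e 1).toLinearEquiv.symm⟩⟩
      rw [isConnected_iff_connectedSpace] at hc ⊢
      exact e.symm.surjective.connectedSpace e.symm.continuous
    · -- torus side
      have hyN : y ∈ capN ρ := hgt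
      have hW : ∀ y' ∈ capN ρ, ∀ q, adkMap hρ1.ne q = y' →
          Surjective (mfderiv (𝓡 4) (𝓡 2) (adkMap hρ1.ne) q) := fun y' hy' q hq =>
        surjective_mfderiv_of_apply_two_ne hρ0 hρ1 q (by rw [hq]; exact (hy' : hcrit ρ < _).ne')
      obtain ⟨e⟩ := nonempty_fibre_homeomorph hρ1.ne isOpen_capN isPreconnected_capN hW
        (northPole_mem_capN hρ0) hyN
      obtain ⟨hc, ⟨l⟩⟩ := northFibre_isConnected_and_homology hρ0 hρ1
      refine ⟨?_, Or.inl ⟨l.trans (singularHomology.mapIso ℤ ℤ e 1).toLinearEquiv.symm⟩⟩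
      rw [isConnected_iff_connectedSpace] at hc ⊢
      exact e.symm.surjective.connectedSpace e.symm.continuous
  exists_higher := by
    refine ⟨northPole, fun q hq => surjective_mfderiv_of_apply_two_ne hρ0 hρ1 q ?_,
      (northFibre_isConnected_and_homology hρ0 hρ1).2⟩
    rw [hq, northPole_apply_two]
    exact (hcrit_lt_one hρ0).ne'
  exists_lower := by
    refine ⟨southPole, fun q hq => surjective_mfderiv_of_apply_two_ne hρ0 hρ1 q ?_,
      (southFibre_isConnected_and_homology hρ1.ne).2⟩
    rw [hq, southPole_apply_two]
    exact (neg_one_lt_hcrit (ρ := ρ)).ne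
  lefschetz_higher := fun p hp => absurd hp (Finset.notMem_empty p)

end AdkSphereFour

/-- **Discharge of the named fact `exists_sblf_genus_one_noLefschetz_sphere_four`**
(Auroux–Donaldson–Katzarkov 2005, §8.2, Example 1: the genus-one broken fibration of `S⁴` with
one round circle and no Lefschetz point): the unit sphere `S⁴ ⊆ ℝ⁵`, with its standard smooth
orientation (`exists_smoothOrientation_sphere`), carries the explicit simplified broken
Lefschetz fibration `AdkSphereFour.adkMap` (`ρ = 1/2`) with empty Lefschetz set and lower genus
`0`. [cite: AurouxDonaldsonKatzarkov2005, §8.2 Example 1] -/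
theorem exists_sblf_genus_one_noLefschetz_sphere_four_holds :
    exists_sblf_genus_one_noLefschetz_sphere_four := by
  obtain ⟨o, -⟩ := exists_smoothOrientation_sphere 4
  exact ⟨o, AdkSphereFour.adkMap (ρ := 1 / 2) (by norm_num),
    AdkSphereFour.isSimplifiedBrokenLefschetzFibration_adkMap (by norm_num) (by norm_num) o⟩

end Literature.Topology.FourManifolds
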